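import Literature.NumberTheory.Sieve.FriedlanderIwaniecPrimesQuadCongr
import Literature.NumberTheory.Sieve.FriedlanderIwaniecPrimesGcdSums
import Literature.NumberTheory.Sieve.LandreauInequality
import Literature.NumberTheory.Sieve.FriedlanderIwaniecPrimesGaussianParam
import HarnessLib

/-!
# Friedlander–Iwaniec, *The polynomial `X² + Y⁴` captures its primes*, Lemma 5.1 (crude form)

Family `parity`, statement parity.S17. Source: J. Friedlander, H. Iwaniec, Ann. of Math. (2) 148
(1998), 945–1040 [FriedlanderIwaniecAnnals1998], §5, Lemma 5.1: "To begin note that we have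
`|𝒟(M, N)| ≤ τ² D(M, N)` where `D(M, N) = Σ_{|w|² ~ M} Σ*_{|z₁|², |z₂|² ~ N} 𝔷(Re w̄ z₁) 𝔷(Re w̄ z₂)`.
Here the `*` indicates summation over primitive `z`. LEMMA 5.1. For every `M ≥ N ≥ 2`,
`D(M, N) ≪ (M^{3/4} N^{3/4} + M^{1/2} N^{3/2}) (log MN)^{514}`." It is the trivial bound that
lets (5.22) insert the condition `(z₁, z₂) = 1` into `𝒟(M, N)` at an admissible cost.

Everything here is PROVED, in a crude form sufficient for (5.22)–(5.24): the exponent of the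
logarithm is unspecified (only powers of `log` matter there), the ranges are full discs
(`0 < |w|² ≤ 32 R_M²`, `0 < |z|² ≤ 2 R_N²` through the boxes `[-R_M, R_M]²`, `[-R_N, R_N]²`), and the
statement is in terms of the box radii `R_M ≍ √M`, `R_N ≍ √N`:

  `D ≤ K ((R_M R_N)^{3/2} + R_M R_N³) (1 + log (R_M R_N))^κ`   for `R_M ≥ R_N ≥ 1`

(`lemma51Count_le`), i.e. `≪ ((MN)^{3/4} + M^{1/2} N^{3/2}) (log MN)^κ`.

## The argument (the source's, made effective)

Write `𝔷(b) = #{c : c² = b}`; then `D` counts the quintuples `(w, z₁, z₂, c₁, c₂)` with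
`Re w̄ z_i = c_i²` (`|c_i| ≤ C₀ = ⌊√(2 R_M R_N)⌋ + 1`, `cRange`).
* Diagonal `Δ(z₁, z₂) = Im z̄₁ z₂ = 0`: for primitive `z_i` this forces `z₂ = ±z₁`, so these are at
  most `4 #{(w, z, c) : Re w̄ z = c²}`; for `z = r + is` primitive and `c` fixed, the `w = u + iv` in
  the box with `ur + vs = c²` lie on a line and project injectively to one residue class of `u`
  modulo `|s|` (or of `v` modulo `|r|`): at most `(2R_M + 1)/max(|r|, |s|) + 1` of them
  (`card_line_box_le`), and `Σ_z 1/max(|r|, |s|) ≤ 4 (2R_N + 1)(1 + log R_N)` (harmonic sums).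
* Off the diagonal, `w` is determined by `(z₁, z₂, c₁, c₂)` through `u Δ = c₁² s₂ - c₂² s₁ =: a`,
  `v Δ = c₂² r₁ - c₁² r₂ =: b`; since `w ≠ 0`, `a ≠ 0` or `b ≠ 0`, and the two cases are exchanged by
  swapping the coordinates. For `a ≠ 0`: `Δ ∣ a`, and by the symmetry `1 ↔ 2` we may take
  `|s₂| ≤ |s₁|`; given `(s₁, s₂, c₁, c₂)` and a divisor `Δ` of `a`, the `(r₁, r₂)` with
  `r₁ s₂ - r₂ s₁ = Δ` number at most `(2R_N + 1)(s₁, s₂)/|s₁| + 1` (`card_det_box_le`). The case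
  `s₂ = 0` is counted directly (`r₂ ∣ c₂²`). For `s₂ ≠ 0` the number of divisors `τ(|a|)` is
  bounded by Landreau's inequality `τ(|a|) ≪ Σ_{d ∣ a, d ≤ |a|^{1/4}} τ(d)^9` (the tree's
  `Landreau.card_divisors_le_sum`, replacing the source's Lemma 2.2), the `(c₁, c₂)` in residue
  classes modulo `d ≤ C₀` are counted with Lemma 9.1 (`quadCongrCount_le`:
  `#{(c₁, c₂) mod d} ≤ τ(d)³ d (s₁ s₂, d)`), and the resulting gcd sums are those of
  `FriedlanderIwaniecPrimesGcdSums`.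

## References

* J. Friedlander, H. Iwaniec, Ann. of Math. (2) 148 (1998), 945–1040, Lemma 5.1 and its proof.
  [FriedlanderIwaniecAnnals1998]

## Contents

`card_le_of_congr`, `intBox`, `card_line_box_le`, `card_det_box_le` (points on lines);
`IsPrimVec`, `primBox`, `reConj`, `det2`, `lemma51Count` (the objects), `cRange`, `quintuples`,
`lemma51Count_eq_card` (Step 0); `eq_or_eq_neg_of_det2_eq_zero`, `triplesP`,
`card_diag_le_four_mul`, `card_diag_le` (the diagonal); `cramer_fst`, `cramer_snd`, `setTa`, `setTb`,
`card_offdiag_le`, `card_setTb_le`, `card_setTa_le`, `setU`, `card_setTa'_le`, `card_r_le`,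
`card_cbox_dvd_le` (off the diagonal); `tauSum`, `wWeight`, `card_setU_le`, `tauSum_snd_zero_le`,
`tauSum_le_landreau`, `sum_nbox_le`, `sum_sPairs_natAbs_le`, `sum_sPairs_zero_le`,
`sum_sPairs_nonzero_le` (the sums); `cRange_bounds`, **`lemma51Count_le`** (Lemma 5.1).

## Tree

`quadCongrCount_le` (`…QuadCongr`); `exists_sum_tau_pow_le_nat`, `exists_sum_tau_pow_gcd_div_le`,
`exists_weighted_pair_sum_le`, `sigma_zero_mul_le` (`…GcdSums`, `DivisorPowerSums`);
`Landreau.card_divisors_le_sum` (`LandreauInequality`); `fiZeta`, `mem_Icc_natAbs_of_sq_eq`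
(`…GaussianParam`). Mathlib: `harmonic_le_one_add_log`, `Finset.card_le_mul_card_image`,
`Finset.sum_comm'`, `Real.pow_rpow_inv_natCast`.
-/

noncomputable section

open Finset Real
open scoped ArithmeticFunction.sigma

namespace Literature.NumberTheory.Sieve.FriedlanderIwaniecPrimes

/-! ### Integers in residue classes -/

/-- Integers in an interval of length `ℓ`, pairwise congruent modulo `m ≥ 1`, are at most
`ℓ/m + 1` in number. [folklore] -/
theorem card_le_of_congr {m : ℕ} (hm : 0 < m) {A : Finset ℤ} {lo : ℤ} {ℓ : ℕ}
    (hA : ∀ u ∈ A, lo ≤ u ∧ u ≤ lo + ℓ) (hcong : ∀ u ∈ A, ∀ u' ∈ A, (m : ℤ) ∣ u - u') :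
    #A ≤ ℓ / m + 1 := by
  have hm0 : (m : ℤ) ≠ 0 := by exact_mod_cast hm.ne'
  have hmaps : ∀ u ∈ A, (u - lo) / m ∈ Icc (0 : ℤ) (ℓ / m : ℕ) := by
    intro u hu
    obtain ⟨h1, h2⟩ := hA u hu
    rw [mem_Icc]
    refine ⟨Int.ediv_nonneg (by linarith) (by positivity), ?_⟩
    rw [Int.natCast_div]
    exact Int.ediv_le_ediv (by exact_mod_cast hm) (by linarith)
  have hinj : Set.InjOn (fun u : ℤ => (u - lo) / m) A := by
    intro u hu u' hu' h
    obtain ⟨t, ht⟩ := hcong u hu u' hu'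
    have e : u - lo = (u' - lo) + m * t := by linarith
    simp only at h
    rw [e, Int.add_mul_ediv_left _ _ hm0] at h
    have ht0 : t = 0 := by linarith
    rw [ht0, mul_zero, sub_eq_zero] at ht
    exact ht
  calc #A ≤ #(Icc (0 : ℤ) (ℓ / m : ℕ)) := card_le_card_of_injOn _ hmaps hinj
    _ = ℓ / m + 1 := by rw [Int.card_Icc, sub_zero]; norm_cast

/-- The box `[-R, R]²`. [folklore] -/
def intBox (R : ℕ) : Finset (ℤ × ℤ) := Icc (-(R : ℤ)) R ×ˢ Icc (-(R : ℤ)) R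

/-- Membership in the box. [folklore] -/
theorem mem_intBox {R : ℕ} {p : ℤ × ℤ} :
    p ∈ intBox R ↔ (-(R : ℤ) ≤ p.1 ∧ p.1 ≤ R) ∧ (-(R : ℤ) ≤ p.2 ∧ p.2 ≤ R) := by
  simp [intBox, mem_product, mem_Icc]

/-- `|p.1|, |p.2| ≤ R` in the box. [folklore] -/
theorem abs_le_of_mem_intBox {R : ℕ} {p : ℤ × ℤ} (h : p ∈ intBox R) : |p.1| ≤ R ∧ |p.2| ≤ R := by
  rw [mem_intBox] at h
  exact ⟨abs_le.mpr h.1, abs_le.mpr h.2⟩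

/-- The box is symmetric under swapping the coordinates. [folklore] -/
theorem swap_mem_intBox {R : ℕ} {p : ℤ × ℤ} (h : p ∈ intBox R) : p.swap ∈ intBox R := by
  rw [mem_intBox] at h ⊢; exact ⟨h.2, h.1⟩

/-- The box is symmetric under negation. [folklore] -/
theorem neg_mem_intBox {R : ℕ} {p : ℤ × ℤ} (h : p ∈ intBox R) : -p ∈ intBox R := by
  rw [mem_intBox] at h ⊢
  simp only [Prod.fst_neg, Prod.snd_neg]
  exact ⟨⟨by linarith [h.1.2], by linarith [h.1.1]⟩, ⟨by linarith [h.2.2], by linarith [h.2.1]⟩⟩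

/-- `#(intBox R) = (2R+1)²`. [folklore] -/
theorem card_intBox (R : ℕ) : #(intBox R) = (2 * R + 1) ^ 2 := by
  rw [intBox, card_product, Int.card_Icc, sq]
  have : ((R : ℤ) + 1 - -(R : ℤ)).toNat = 2 * R + 1 := by
    rw [show (R : ℤ) + 1 - -(R : ℤ) = ((2 * R + 1 : ℕ) : ℤ) by push_cast; ring, Int.toNat_natCast]
  rw [this]

/-! ### Points on lines in boxes -/

/-- **Lattice points on a line in a box, core case.** For `(r, s) = 1` with `|r| ≤ |s|` and any
`k`, the `(u, v) ∈ [-R, R]²` with `u r + v s = k` are at most `2R/|s| + 1` in number: `u`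
determines `v`, and the admissible `u` lie in one residue class modulo `|s|`. [folklore] -/
theorem card_line_box_le_core {r s : ℤ} (hrs : Int.gcd r s = 1) (hle : |r| ≤ |s|) (k : ℤ)
    (R : ℕ) :
    #((intBox R).filter fun uv : ℤ × ℤ => uv.1 * r + uv.2 * s = k) ≤ 2 * R / s.natAbs + 1 := by
  set S := (intBox R).filter fun uv : ℤ × ℤ => uv.1 * r + uv.2 * s = k with hS
  have hs0 : s ≠ 0 := by
    intro h0
    rw [h0, abs_zero] at hle
    have hr0 : r = 0 := abs_nonpos_iff.mp hle
    rw [hr0, h0] at hrs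
    simp at hrs
  have hsabs : 0 < s.natAbs := Int.natAbs_pos.mpr hs0
  -- `u` determines `v`
  have hinj : Set.InjOn (fun uv : ℤ × ℤ => uv.1) S := by
    intro p hp p' hp' h
    rw [hS, mem_coe, mem_filter] at hp hp'
    simp only at h
    have h1 := hp.2
    rw [h] at h1
    have h2 : p.2 * s = p'.2 * s := by linarith [hp'.2]
    exact Prod.ext h (mul_right_cancel₀ hs0 h2)
  rw [← card_image_of_injOn hinj]
  refine card_le_of_congr hsabs (lo := -(R : ℤ)) (ℓ := 2 * R) ?_ ?_
  · intro u hu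
    obtain ⟨p, hp, rfl⟩ := mem_image.mp hu
    rw [hS, mem_filter] at hp
    have := (mem_intBox.mp hp.1).1
    constructor
    · exact this.1
    · push_cast; linarith [this.2]
  · intro u hu u' hu'
    obtain ⟨p, hp, rfl⟩ := mem_image.mp hu
    obtain ⟨p', hp', rfl⟩ := mem_image.mp hu'
    rw [hS, mem_filter] at hp hp'
    have h1 : s ∣ (p.1 - p'.1) * r := by
      have e : (p.1 - p'.1) * r = -((p.2 - p'.2) * s) := by linarith [hp.2, hp'.2]
      rw [e, dvd_neg]; exact dvd_mul_left s _
    have h2 : s ∣ p.1 - p'.1 := Int.dvd_of_dvd_mul_left_of_gcd_one h1 (by rwa [Int.gcd_comm])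
    exact (Int.natAbs_dvd.mpr h2 : (s.natAbs : ℤ) ∣ p.1 - p'.1)

/-- **Lattice points on a line in a box** (FI, proof of (5.10) and of (5.16): "Given `c, r, s` the
residue class of `u (mod s)` is fixed and then `v` is determined"). For `(r, s) = 1` and any `k`:
`#{(u, v) ∈ [-R, R]² : u r + v s = k} ≤ (2R + 1)/max(|r|, |s|) + 1`.
[cite: FriedlanderIwaniecAnnals1998, §5, proof of (5.10)] -/
theorem card_line_box_le {r s : ℤ} (hrs : Int.gcd r s = 1) (k : ℤ) (R : ℕ) :
    (#((intBox R).filter fun uv : ℤ × ℤ => uv.1 * r + uv.2 * s = k) : ℝ) ≤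
      (2 * R + 1 : ℝ) / max |r| |s| + 1 := by
  -- reduce to the core case by swapping the coordinates if necessary
  have key : ∀ r s : ℤ, Int.gcd r s = 1 → |r| ≤ |s| →
      (#((intBox R).filter fun uv : ℤ × ℤ => uv.1 * r + uv.2 * s = k) : ℝ) ≤
        (2 * R + 1 : ℝ) / |s| + 1 := by
    intro r s hrs hle
    have h := card_line_box_le_core hrs hle k R
    have hs0 : 0 < s.natAbs := by
      rw [Int.natAbs_pos]; intro h0
      rw [h0, abs_zero] at hle
      rw [abs_nonpos_iff.mp hle, h0] at hrs; simp at hrs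
    have hsR : (0 : ℝ) < |s| := by exact_mod_cast abs_pos.mpr (Int.natAbs_pos.mp hs0)
    calc (#((intBox R).filter fun uv : ℤ × ℤ => uv.1 * r + uv.2 * s = k) : ℝ)
        ≤ ((2 * R / s.natAbs + 1 : ℕ) : ℝ) := by exact_mod_cast h
      _ ≤ (2 * R : ℝ) / s.natAbs + 1 := by
          have := (Nat.cast_div_le : ((2 * R / s.natAbs : ℕ) : ℝ) ≤ (2 * R : ℕ) / (s.natAbs : ℕ))
          push_cast at this ⊢
          linarith
      _ ≤ (2 * R + 1 : ℝ) / |s| + 1 := by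
          rw [Nat.cast_natAbs, Int.cast_abs]
          gcongr
          linarith
  rcases le_total |r| |s| with hle | hle
  · rw [max_eq_right hle]; exact key r s hrs hle
  · rw [max_eq_left hle]
    have hsr : Int.gcd s r = 1 := by rwa [Int.gcd_comm]
    have hswap : #((intBox R).filter fun uv : ℤ × ℤ => uv.1 * r + uv.2 * s = k) =
        #((intBox R).filter fun uv : ℤ × ℤ => uv.1 * s + uv.2 * r = k) := by
      refine card_bij (fun p _ => p.swap) ?_ ?_ ?_
      · intro p hp
        rw [mem_filter] at hp ⊢
        exact ⟨swap_mem_intBox hp.1, by simp only [Prod.fst_swap, Prod.snd_swap]; linarith [hp.2]⟩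
      · intro p _ p' _ h
        exact Prod.swap_injective h
      · intro q hq
        rw [mem_filter] at hq
        refine ⟨q.swap, ?_, Prod.swap_swap q⟩
        rw [mem_filter]
        exact ⟨swap_mem_intBox hq.1, by simp only [Prod.fst_swap, Prod.snd_swap]; linarith [hq.2]⟩
    rw [hswap]
    exact key s r hsr hle

/-- **Pairs with a given determinant** (FI, proof of Lemma 5.1: "For given `c₁, c₂, s₁, s₂, Δ ≠ 0`,
the number `r₁` is fixed mod `s₁/(s₁, s₂)` and then `r₂` is determined. The number of pairs `r₁, r₂`
is bounded by `√N (s₁, s₂)/s₁`"): for `s₁ ≠ 0` and any `Δ`,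
`#{(r₁, r₂) ∈ [-R, R]² : r₁ s₂ - r₂ s₁ = Δ} ≤ (2R + 1)(s₁, s₂)/|s₁| + 1`.
[cite: FriedlanderIwaniecAnnals1998, proof of Lemma 5.1] -/
theorem card_det_box_le {s₁ : ℤ} (hs₁ : s₁ ≠ 0) (s₂ Δ : ℤ) (R : ℕ) :
    (#((intBox R).filter fun r : ℤ × ℤ => r.1 * s₂ - r.2 * s₁ = Δ) : ℝ) ≤
      (2 * R + 1 : ℝ) * Int.gcd s₁ s₂ / |s₁| + 1 := by
  set S := (intBox R).filter fun r : ℤ × ℤ => r.1 * s₂ - r.2 * s₁ = Δ with hS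
  set g : ℕ := Int.gcd s₁ s₂ with hg
  have hg0 : 0 < g := Int.gcd_pos_of_ne_zero_left _ hs₁
  set m : ℕ := s₁.natAbs / g with hm
  have hgdvd : (g : ℤ) ∣ s₁ := Int.gcd_dvd_left ..
  have hgdvd' : g ∣ s₁.natAbs := Int.natCast_dvd.mp hgdvd
  have hm0 : 0 < m := Nat.div_pos (Nat.le_of_dvd (Int.natAbs_pos.mpr hs₁) hgdvd') hg0
  have hms : s₁.natAbs = g * m := (Nat.mul_div_cancel' hgdvd').symm
  -- `r₁` determines `r₂`
  have hinj : Set.InjOn (fun r : ℤ × ℤ => r.1) S := by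
    intro p hp p' hp' h
    rw [hS, mem_coe, mem_filter] at hp hp'
    simp only at h
    have h1 := hp.2
    rw [h] at h1
    have h2 : p.2 * s₁ = p'.2 * s₁ := by linarith [hp'.2]
    exact Prod.ext h (mul_right_cancel₀ hs₁ h2)
  have hcard : #S ≤ 2 * R / m + 1 := by
    rw [← card_image_of_injOn hinj]
    refine card_le_of_congr hm0 (lo := -(R : ℤ)) (ℓ := 2 * R) ?_ ?_
    · intro u hu
      obtain ⟨p, hp, rfl⟩ := mem_image.mp hu
      rw [hS, mem_filter] at hp
      have := (mem_intBox.mp hp.1).1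
      exact ⟨this.1, by push_cast; linarith [this.2]⟩
    · intro u hu u' hu'
      obtain ⟨p, hp, rfl⟩ := mem_image.mp hu
      obtain ⟨p', hp', rfl⟩ := mem_image.mp hu'
      rw [hS, mem_filter] at hp hp'
      -- s₁ ∣ (p.1 - p'.1) s₂, divide by g
      have h1 : s₁ ∣ (p.1 - p'.1) * s₂ := by
        have e : (p.1 - p'.1) * s₂ = (p.2 - p'.2) * s₁ := by linarith [hp.2, hp'.2]
        rw [e]; exact dvd_mul_left s₁ _
      obtain ⟨a, ha⟩ : (g : ℤ) ∣ s₁ := hgdvd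
      obtain ⟨b, hb⟩ : (g : ℤ) ∣ s₂ := Int.gcd_dvd_right ..
      have hab : Int.gcd a b = 1 := by
        have := Int.gcd_div_gcd_div_gcd (Int.gcd_pos_of_ne_zero_left s₂ hs₁)
        rw [← hg] at this
        have ea : s₁ / g = a := by rw [ha, Int.mul_ediv_cancel_left _ (by exact_mod_cast hg0.ne')]
        have eb : s₂ / g = b := by rw [hb, Int.mul_ediv_cancel_left _ (by exact_mod_cast hg0.ne')]
        rwa [ea, eb] at this
      have h2 : a ∣ (p.1 - p'.1) * b := by
        rw [ha, hb] at h1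
        have : (g : ℤ) * a ∣ (g : ℤ) * ((p.1 - p'.1) * b) := by
          rw [show (g : ℤ) * ((p.1 - p'.1) * b) = (p.1 - p'.1) * (g * b) by ring]; exact h1
        exact (mul_dvd_mul_iff_left (by exact_mod_cast hg0.ne')).mp this
      have h3 : a ∣ p.1 - p'.1 := Int.dvd_of_dvd_mul_left_of_gcd_one h2 hab
      have hma : (m : ℤ) ∣ a := by
        have : (m : ℤ) = a ∨ (m : ℤ) = -a := by
          have h4 : (s₁.natAbs : ℤ) = g * m := by rw [hms]; push_cast; ring
          rcases Int.natAbs_eq s₁ with h5 | h5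
          · left
            have : (g : ℤ) * m = g * a := by rw [← h4, ← h5, ha]
            exact mul_left_cancel₀ (by exact_mod_cast hg0.ne') this
          · right
            have : (g : ℤ) * m = g * (-a) := by rw [← h4, mul_neg, ← ha]; linarith
            exact mul_left_cancel₀ (by exact_mod_cast hg0.ne') this
        rcases this with h5 | h5
        · rw [h5]
        · rw [h5]; exact neg_dvd.mpr dvd_rfl
      exact hma.trans h3
  have hs₁R : ((|s₁| : ℤ) : ℝ) = (g : ℝ) * m := by
    rw [Int.abs_eq_natAbs, hms]; push_cast; ring
  have hmR : (0 : ℝ) < m := by exact_mod_cast hm0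
  have hgR : (0 : ℝ) < g := by exact_mod_cast hg0
  calc (#S : ℝ) ≤ ((2 * R / m + 1 : ℕ) : ℝ) := by exact_mod_cast hcard
    _ ≤ (2 * R : ℝ) / m + 1 := by
        have := (Nat.cast_div_le : ((2 * R / m : ℕ) : ℝ) ≤ (2 * R : ℕ) / (m : ℕ))
        push_cast at this ⊢
        linarith
    _ = (2 * R : ℝ) * g / |s₁| + 1 := by rw [hs₁R]; field_simp
    _ ≤ (2 * R + 1 : ℝ) * g / |s₁| + 1 := by
        rw [hs₁R]; gcongr; linarith

/-! ### The objects of Lemma 5.1 -/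

/-- Primitive integer vectors `z = (r, s)`: `(r, s) = 1` (in particular `z ≠ 0`). [folklore] -/
def IsPrimVec (z : ℤ × ℤ) : Prop := Int.gcd z.1 z.2 = 1

/-- Primitivity is decidable. [folklore] -/
instance : DecidablePred IsPrimVec := fun _ => inferInstanceAs (Decidable (_ = _))

/-- A primitive vector is nonzero. [folklore] -/
theorem IsPrimVec.ne_zero {z : ℤ × ℤ} (h : IsPrimVec z) : z ≠ 0 := by
  rintro rfl; simp [IsPrimVec] at h

/-- Primitivity is symmetric in the coordinates. [folklore] -/
theorem IsPrimVec.swap {z : ℤ × ℤ} (h : IsPrimVec z) : IsPrimVec z.swap := by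
  unfold IsPrimVec at h ⊢; rwa [Prod.fst_swap, Prod.snd_swap, Int.gcd_comm]

/-- Primitivity is invariant under negation. [folklore] -/
theorem IsPrimVec.neg {z : ℤ × ℤ} (h : IsPrimVec z) : IsPrimVec (-z) := by
  unfold IsPrimVec at h ⊢
  simp only [Prod.fst_neg, Prod.snd_neg, Int.gcd, Int.natAbs_neg] at h ⊢
  exact h

/-- The primitive vectors of the box `[-R, R]²` (the `z = r + is` of `D(M, N)`, `|z|² ≤ 2R²`).
[cite: FriedlanderIwaniecAnnals1998, Lemma 5.1] -/
def primBox (R : ℕ) : Finset (ℤ × ℤ) := (intBox R).filter IsPrimVec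

/-- Membership in `primBox`. [folklore] -/
theorem mem_primBox {R : ℕ} {z : ℤ × ℤ} : z ∈ primBox R ↔ z ∈ intBox R ∧ IsPrimVec z := mem_filter

/-- `primBox R ⊆ intBox R`. [folklore] -/
theorem primBox_subset (R : ℕ) : primBox R ⊆ intBox R := filter_subset _ _

/-- `Re(w̄ z) = u r + v s` for `w = (u, v)`, `z = (r, s)` (the first coordinate of
`gaussMulConj w z`). [cite: FriedlanderIwaniecAnnals1998, (5.2)] -/
def reConj (w z : ℤ × ℤ) : ℤ := w.1 * z.1 + w.2 * z.2

/-- The determinant `Δ(z₁, z₂) = r₁ s₂ - r₂ s₁ = Im(z̄₁ z₂)` ((6.1), (6.5)).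
[cite: FriedlanderIwaniecAnnals1998, (6.5)] -/
def det2 (z₁ z₂ : ℤ × ℤ) : ℤ := z₁.1 * z₂.2 - z₂.1 * z₁.2

/-- **`D` of Lemma 5.1 over boxes**: `Σ_{w ∈ [-R_M, R_M]², w ≠ 0} Σ_{z₁, z₂ ∈ [-R_N, R_N]² primitive}
𝔷(Re w̄ z₁) 𝔷(Re w̄ z₂)`. [cite: FriedlanderIwaniecAnnals1998, Lemma 5.1] -/
def lemma51Count (RM RN : ℕ) : ℕ :=
  ∑ w ∈ (intBox RM).filter (· ≠ 0), ∑ z₁ ∈ primBox RN, ∑ z₂ ∈ primBox RN,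
    fiZeta (reConj w z₁) * fiZeta (reConj w z₂)

/-- The bound `C₀` for `|c|` when `c² = Re w̄ z`: `⌊√(2 R_M R_N)⌋ + 1`. [folklore] -/
def cRange (RM RN : ℕ) : ℕ := Nat.sqrt (2 * RM * RN) + 1

/-! ### Step 0: `D` counts quintuples -/

/-- `𝔷(b)` counted in a fixed range containing all square roots of `b`. [folklore] -/
theorem fiZeta_eq_card {b : ℤ} {C : ℕ} (hb : b.natAbs < C ^ 2) :
    fiZeta b = #((Icc (-(C : ℤ)) C).filter fun c => c ^ 2 = b) := by
  unfold fiZeta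
  congr 1
  ext c
  simp only [mem_filter, mem_Icc]
  constructor
  · rintro ⟨-, hc⟩
    refine ⟨?_, hc⟩
    have h1 : c.natAbs ^ 2 < C ^ 2 := by
      have : c.natAbs ^ 2 = b.natAbs := by rw [← Int.natAbs_pow, hc]
      omega
    have h2 : c.natAbs < C := (Nat.pow_lt_pow_iff_left (by norm_num)).mp h1
    constructor <;> omega
  · rintro ⟨-, hc⟩
    exact ⟨mem_Icc.mp (mem_Icc_natAbs_of_sq_eq hc), hc⟩

/-- `|Re w̄ z| ≤ 2 R_M R_N` on the boxes. [folklore] -/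
theorem natAbs_reConj_le {RM RN : ℕ} {w z : ℤ × ℤ} (hw : w ∈ intBox RM) (hz : z ∈ intBox RN) :
    (reConj w z).natAbs ≤ 2 * RM * RN := by
  obtain ⟨hu, hv⟩ := abs_le_of_mem_intBox hw
  obtain ⟨hr, hs⟩ := abs_le_of_mem_intBox hz
  have h : |reConj w z| ≤ 2 * RM * RN := by
    unfold reConj
    calc |w.1 * z.1 + w.2 * z.2| ≤ |w.1 * z.1| + |w.2 * z.2| := abs_add_le _ _
      _ = |w.1| * |z.1| + |w.2| * |z.2| := by rw [abs_mul, abs_mul]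
      _ ≤ RM * RN + RM * RN := by
          gcongr
      _ = 2 * RM * RN := by ring
  have : ((reConj w z).natAbs : ℤ) ≤ 2 * RM * RN := by rwa [Int.natCast_natAbs]
  exact_mod_cast this

/-- `2 R_M R_N < C₀²`. [folklore] -/
theorem two_mul_lt_cRange_sq (RM RN : ℕ) : 2 * RM * RN < cRange RM RN ^ 2 :=
  Nat.lt_succ_sqrt' _

/-- The quintuples `(w, z₁, z₂, c₁, c₂)` with `Re w̄ z_i = c_i²`. [cite: FriedlanderIwaniecAnnals1998, proof of Lemma 5.1] -/
def quintuples (RM RN : ℕ) : Finset (((ℤ × ℤ) × (ℤ × ℤ) × (ℤ × ℤ)) × (ℤ × ℤ)) :=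
  ((((intBox RM).filter (· ≠ 0)) ×ˢ (primBox RN ×ˢ primBox RN)) ×ˢ intBox (cRange RM RN)).filter
    fun x => reConj x.1.1 x.1.2.1 = x.2.1 ^ 2 ∧ reConj x.1.1 x.1.2.2 = x.2.2 ^ 2

/-- **Step 0**: `D = #quintuples`. [cite: FriedlanderIwaniecAnnals1998, proof of Lemma 5.1] -/
theorem lemma51Count_eq_card (RM RN : ℕ) : lemma51Count RM RN = #(quintuples RM RN) := by
  unfold quintuples lemma51Count
  rw [card_filter, sum_product, sum_product]
  refine sum_congr rfl fun w hw => ?_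
  rw [sum_product]
  refine sum_congr rfl fun z₁ hz₁ => sum_congr rfl fun z₂ hz₂ => ?_
  rw [mem_filter] at hw
  have hb : ∀ z ∈ intBox RN, (reConj w z).natAbs < cRange RM RN ^ 2 := fun z hz =>
    lt_of_le_of_lt (natAbs_reConj_le hw.1 hz) (two_mul_lt_cRange_sq RM RN)
  rw [fiZeta_eq_card (hb z₁ (primBox_subset RN hz₁)), fiZeta_eq_card (hb z₂ (primBox_subset RN hz₂)),
    ← card_product, ← filter_product, ← card_filter]
  unfold intBox
  congr 1
  refine filter_congr fun c _ => ?_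
  simp only
  constructor <;> rintro ⟨h1, h2⟩ <;> exact ⟨h1.symm, h2.symm⟩

/-! ### The diagonal `Δ = 0` -/

/-- For primitive `z₁, z₂`, `Δ(z₁, z₂) = 0` forces `z₂ = ±z₁`. [folklore] -/
theorem eq_or_eq_neg_of_det2_eq_zero {z₁ z₂ : ℤ × ℤ} (h1 : IsPrimVec z₁) (h2 : IsPrimVec z₂)
    (h : det2 z₁ z₂ = 0) : z₂ = z₁ ∨ z₂ = -z₁ := by
  unfold det2 at h
  unfold IsPrimVec at h1 h2
  have e : z₁.1 * z₂.2 = z₂.1 * z₁.2 := by linarith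
  -- mutual divisibilities
  have k1 : z₁.1 * z₂.2 = z₁.2 * z₂.1 := by rw [e, mul_comm]
  have k2 : z₂.1 * z₁.2 = z₂.2 * z₁.1 := by rw [← e, mul_comm]
  have k3 : z₁.2 * z₂.1 = z₁.1 * z₂.2 := by rw [mul_comm]; exact e.symm
  have k4 : z₂.2 * z₁.1 = z₂.1 * z₁.2 := by rw [mul_comm]; exact e
  have d1 : z₁.1 ∣ z₂.1 := Int.dvd_of_dvd_mul_right_of_gcd_one (Dvd.intro z₂.2 k1) h1
  have d2 : z₂.1 ∣ z₁.1 := Int.dvd_of_dvd_mul_right_of_gcd_one (Dvd.intro z₁.2 k2) h2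
  have d3 : z₁.2 ∣ z₂.2 := by
    refine Int.dvd_of_dvd_mul_right_of_gcd_one (Dvd.intro z₂.1 k3) ?_
    rwa [Int.gcd_comm]
  have d4 : z₂.2 ∣ z₁.2 := by
    refine Int.dvd_of_dvd_mul_right_of_gcd_one (Dvd.intro z₁.1 k4) ?_
    rwa [Int.gcd_comm]
  have ha : z₂.1 = z₁.1 ∨ z₂.1 = -z₁.1 :=
    Int.natAbs_eq_natAbs_iff.mp (Nat.dvd_antisymm (Int.natAbs_dvd_natAbs.mpr d2)
      (Int.natAbs_dvd_natAbs.mpr d1))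
  have hb : z₂.2 = z₁.2 ∨ z₂.2 = -z₁.2 :=
    Int.natAbs_eq_natAbs_iff.mp (Nat.dvd_antisymm (Int.natAbs_dvd_natAbs.mpr d4)
      (Int.natAbs_dvd_natAbs.mpr d3))
  rcases ha with ha | ha <;> rcases hb with hb | hb
  · left; exact Prod.ext ha hb
  · -- (+, -): then z₁.1 z₁.2 = 0
    rw [ha, hb] at e
    have hz : z₁.1 * z₁.2 = 0 := by linarith
    rcases mul_eq_zero.mp hz with h0 | h0
    · right; refine Prod.ext ?_ ?_ <;> simp [ha, hb, h0]
    · left; refine Prod.ext ha ?_; rw [hb, h0, neg_zero]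
  · rw [ha, hb] at e
    have hz : z₁.1 * z₁.2 = 0 := by linarith
    rcases mul_eq_zero.mp hz with h0 | h0
    · left; refine Prod.ext ?_ hb; rw [ha, h0, neg_zero]
    · right; refine Prod.ext ?_ ?_ <;> simp [ha, hb, h0]
  · right; exact Prod.ext (by simp [ha]) (by simp [hb])

/-- The triples `(z, c, w)` with `Re w̄ z = c²`. [cite: FriedlanderIwaniecAnnals1998, proof of Lemma 5.1] -/
def triplesP (RM RN : ℕ) : Finset ((ℤ × ℤ) × ℤ × (ℤ × ℤ)) :=
  (primBox RN ×ˢ (Icc (-(cRange RM RN : ℤ)) (cRange RM RN) ×ˢ (intBox RM).filter (· ≠ 0))).filter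
    fun y => reConj y.2.2 y.1 = y.2.1 ^ 2

/-- **The diagonal quintuples are at most `4 #triplesP`**: `z₂ = ±z₁`, `c₂ = ±c₁`.
[cite: FriedlanderIwaniecAnnals1998, proof of Lemma 5.1 ("The contribution of the diagonal")] -/
theorem card_diag_le_four_mul (RM RN : ℕ) :
    #((quintuples RM RN).filter fun x => det2 x.1.2.1 x.1.2.2 = 0) ≤ 4 * #(triplesP RM RN) := by
  set Q₀ := (quintuples RM RN).filter fun x => det2 x.1.2.1 x.1.2.2 = 0 with hQ₀
  set f : (((ℤ × ℤ) × (ℤ × ℤ) × (ℤ × ℤ)) × (ℤ × ℤ)) → ((ℤ × ℤ) × ℤ × (ℤ × ℤ)) :=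
    fun x => (x.1.2.1, (x.2.1, x.1.1)) with hf
  have hmem : ∀ x ∈ Q₀, x.1.1 ∈ (intBox RM).filter (· ≠ 0) ∧ x.1.2.1 ∈ primBox RN ∧
      x.1.2.2 ∈ primBox RN ∧ x.2 ∈ intBox (cRange RM RN) ∧
      reConj x.1.1 x.1.2.1 = x.2.1 ^ 2 ∧ reConj x.1.1 x.1.2.2 = x.2.2 ^ 2 ∧
      det2 x.1.2.1 x.1.2.2 = 0 := by
    intro x hx
    rw [hQ₀, mem_filter] at hx
    unfold quintuples at hx
    rw [mem_filter, mem_product, mem_product, mem_product] at hx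
    tauto
  have himg : Q₀.image f ⊆ triplesP RM RN := by
    intro y hy
    obtain ⟨x, hx, rfl⟩ := mem_image.mp hy
    obtain ⟨hw, hz₁, -, hc, h1, -, -⟩ := hmem x hx
    simp only [triplesP, hf, mem_filter, mem_product]
    exact ⟨⟨hz₁, (mem_intBox.mp hc).1 |> fun h => mem_Icc.mpr h, mem_filter.mp hw⟩, h1⟩
  have hfib : ∀ y ∈ Q₀.image f, #(Q₀.filter fun x => f x = y) ≤ 4 := by
    intro y hy
    obtain ⟨x₀, hx₀, rfl⟩ := mem_image.mp hy
    -- the fibre lies in an explicit 4-element set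
    set mk : (ℤ × ℤ) → ℤ → (((ℤ × ℤ) × (ℤ × ℤ) × (ℤ × ℤ)) × (ℤ × ℤ)) :=
      fun z₂ c₂ => ((x₀.1.1, (x₀.1.2.1, z₂)), (x₀.2.1, c₂)) with hmk
    have hsub : (Q₀.filter fun x => f x = f x₀) ⊆
        {mk x₀.1.2.1 x₀.2.1, mk x₀.1.2.1 (-x₀.2.1), mk (-x₀.1.2.1) x₀.2.1,
          mk (-x₀.1.2.1) (-x₀.2.1)} := by
      intro x hx
      rw [mem_filter] at hx
      obtain ⟨hxQ, hxf⟩ := hx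
      obtain ⟨-, hz₁, hz₂, -, h1, h2, hΔ⟩ := hmem x hxQ
      simp only [hf, Prod.mk.injEq] at hxf
      obtain ⟨e1, e2, e3⟩ := hxf
      -- x = ((x.1.1, (x.1.2.1, x.1.2.2)), (x.2.1, x.2.2)) with x.1.1 = w etc.
      have hprim₁ := (mem_primBox.mp hz₁).2
      have hprim₂ := (mem_primBox.mp hz₂).2
      have hx : mk x.1.2.2 x.2.2 = x := by rw [hmk, ← e1, ← e2, ← e3]
      rw [← hx]
      rcases eq_or_eq_neg_of_det2_eq_zero hprim₁ hprim₂ hΔ with hz | hz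
      · -- z₂ = z₁: c₂² = c₁²
        have hc : x.2.2 ^ 2 = x.2.1 ^ 2 := by rw [← h1, ← h2, hz]
        rcases sq_eq_sq_iff_eq_or_eq_neg.mp hc with hc' | hc'
        · rw [hz, hc', e1, e2]; simp
        · rw [hz, hc', e1, e2]; simp
      · -- z₂ = -z₁: c₂² = -c₁², so c₁ = c₂ = 0
        have hneg : reConj x.1.1 (-x.1.2.1) = -reConj x.1.1 x.1.2.1 := by
          simp only [reConj, Prod.fst_neg, Prod.snd_neg]; ring
        have hc : x.2.2 ^ 2 = -(x.2.1 ^ 2) := by rw [← h1, ← h2, hz, hneg]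
        have hc0 : x.2.2 = 0 ∧ x.2.1 = 0 := by
          constructor <;> nlinarith [sq_nonneg x.2.2, sq_nonneg x.2.1]
        have hc0' : x.2.2 = x.2.1 := by rw [hc0.1, hc0.2]
        rw [hz, hc0', e1, e2]; simp
    calc #(Q₀.filter fun x => f x = f x₀)
        ≤ #({mk x₀.1.2.1 x₀.2.1, mk x₀.1.2.1 (-x₀.2.1), mk (-x₀.1.2.1) x₀.2.1,
            mk (-x₀.1.2.1) (-x₀.2.1)} : Finset _) := card_le_card hsub
      _ ≤ 4 := by
          refine (card_insert_le _ _).trans (Nat.succ_le_succ ((card_insert_le _ _).trans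
            (Nat.succ_le_succ ((card_insert_le _ _).trans (Nat.succ_le_succ ?_)))))
          rw [card_singleton]
  calc #Q₀ ≤ 4 * #(Q₀.image f) := card_le_mul_card_image _ 4 hfib
    _ ≤ 4 * #(triplesP RM RN) := Nat.mul_le_mul_left 4 (card_le_card himg)

/-- `#triplesP` as an iterated sum of line counts. [folklore] -/
theorem card_triplesP_eq (RM RN : ℕ) : #(triplesP RM RN) =
    ∑ z ∈ primBox RN, ∑ c ∈ Icc (-(cRange RM RN : ℤ)) (cRange RM RN),
      #(((intBox RM).filter (· ≠ 0)).filter fun w => reConj w z = c ^ 2) := by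
  unfold triplesP
  rw [card_filter, sum_product]
  refine sum_congr rfl fun z _ => ?_
  rw [sum_product]
  refine sum_congr rfl fun c _ => ?_
  rw [card_filter]

/-- Harmonic sums: `∑_{1 ≤ k ≤ n} 1/k ≤ 1 + log n`. [folklore] -/
theorem sum_Icc_one_div_le (n : ℕ) : ∑ k ∈ Icc 1 n, (1 : ℝ) / k ≤ 1 + Real.log n := by
  have h := harmonic_le_one_add_log n
  rw [harmonic_eq_sum_Icc] at h
  push_cast at h
  simpa [one_div] using h

/-- `∑_{-n ≤ r ≤ n} 1/|r| ≤ 2 (1 + log n)` (the term `r = 0` is `1/0 = 0`). [folklore] -/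
theorem sum_Icc_one_div_natAbs_le (n : ℕ) :
    ∑ r ∈ Icc (-(n : ℤ)) n, (1 : ℝ) / r.natAbs ≤ 2 * (1 + Real.log n) := by
  rw [sum_comp (fun k : ℕ => (1 : ℝ) / k) Int.natAbs]
  have hfib : ∀ k ∈ (Icc (-(n : ℤ)) n).image Int.natAbs,
      #((Icc (-(n : ℤ)) n).filter fun r => r.natAbs = k) ≤ 2 := by
    intro k _
    calc #((Icc (-(n : ℤ)) n).filter fun r => r.natAbs = k)
        ≤ #({(k : ℤ), -(k : ℤ)} : Finset ℤ) := by
          refine card_le_card fun r hr => ?_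
          rw [mem_filter] at hr
          rcases Int.natAbs_eq r with h | h <;> rw [hr.2] at h <;> simp [h]
      _ ≤ 2 := card_insert_le _ _ |>.trans (by rw [card_singleton])
  have himg : (Icc (-(n : ℤ)) n).image Int.natAbs ⊆ Icc 0 n := by
    intro k hk
    obtain ⟨r, hr, rfl⟩ := mem_image.mp hk
    rw [mem_Icc] at hr ⊢
    constructor
    · exact Nat.zero_le _
    · have : (r.natAbs : ℤ) ≤ n := by rw [Int.natCast_natAbs]; exact abs_le.mpr hr
      exact_mod_cast this
  calc ∑ k ∈ (Icc (-(n : ℤ)) n).image Int.natAbs,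
        #((Icc (-(n : ℤ)) n).filter fun r => r.natAbs = k) • ((1 : ℝ) / k)
      ≤ ∑ k ∈ (Icc (-(n : ℤ)) n).image Int.natAbs, (2 : ℝ) * ((1 : ℝ) / k) := by
        refine sum_le_sum fun k hk => ?_
        rw [nsmul_eq_mul]
        exact mul_le_mul_of_nonneg_right (by exact_mod_cast hfib k hk) (by positivity)
    _ ≤ ∑ k ∈ Icc 0 n, (2 : ℝ) * ((1 : ℝ) / k) :=
        sum_le_sum_of_subset_of_nonneg himg fun _ _ _ => by positivity
    _ = 2 * ∑ k ∈ Icc 1 n, (1 : ℝ) / k := by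
        rw [← mul_sum, show Icc 0 n = insert 0 (Icc 1 n) by
          rw [show (Icc 1 n : Finset ℕ) = Ioc 0 n from Finset.Icc_add_one_left_eq_Ioc 0 n,
            Finset.Ioc_insert_left (Nat.zero_le n)], sum_insert (by simp)]
        simp
    _ ≤ 2 * (1 + Real.log n) := by
        have := sum_Icc_one_div_le n; linarith

/-- `1/max(|r|, |s|) ≤ 1/|r| + 1/|s|` with the convention `1/0 = 0`. [folklore] -/
theorem one_div_max_le (r s : ℤ) :
    (1 : ℝ) / max (r.natAbs : ℝ) s.natAbs ≤ 1 / r.natAbs + 1 / s.natAbs := by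
  rcases Nat.eq_zero_or_pos r.natAbs with hr | hr
  · rw [hr]; simp
  · have h1 : (1 : ℝ) / max (r.natAbs : ℝ) s.natAbs ≤ 1 / r.natAbs :=
      one_div_le_one_div_of_le (by exact_mod_cast hr) (le_max_left _ _)
    have h2 : (0 : ℝ) ≤ 1 / s.natAbs := by positivity
    linarith

/-- `∑_{z ∈ [-R, R]²} 1/max(|r|, |s|) ≤ 4 (2R + 1)(1 + log R)`. [folklore] -/
theorem sum_intBox_one_div_max_le (R : ℕ) :
    ∑ z ∈ intBox R, (1 : ℝ) / max (z.1.natAbs : ℝ) z.2.natAbs ≤ 4 * (2 * R + 1) * (1 + Real.log R) := by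
  have hcard : #(Icc (-(R : ℤ)) R) = 2 * R + 1 := by
    rw [Int.card_Icc]
    rw [show (R : ℤ) + 1 - -(R : ℤ) = ((2 * R + 1 : ℕ) : ℤ) by push_cast; ring, Int.toNat_natCast]
  calc ∑ z ∈ intBox R, (1 : ℝ) / max (z.1.natAbs : ℝ) z.2.natAbs
      ≤ ∑ z ∈ intBox R, ((1 : ℝ) / z.1.natAbs + 1 / z.2.natAbs) :=
        sum_le_sum fun z _ => one_div_max_le z.1 z.2
    _ = ∑ r ∈ Icc (-(R : ℤ)) R, ∑ s ∈ Icc (-(R : ℤ)) R, ((1 : ℝ) / r.natAbs + 1 / s.natAbs) := by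
        unfold intBox; rw [sum_product]
    _ = ∑ r ∈ Icc (-(R : ℤ)) R, ((2 * R + 1) * ((1 : ℝ) / r.natAbs) +
          ∑ s ∈ Icc (-(R : ℤ)) R, (1 : ℝ) / s.natAbs) := by
        refine sum_congr rfl fun r _ => ?_
        rw [sum_add_distrib, sum_const, hcard, nsmul_eq_mul]; push_cast; ring
    _ = (2 * R + 1) * ∑ r ∈ Icc (-(R : ℤ)) R, (1 : ℝ) / r.natAbs +
          (2 * R + 1) * ∑ s ∈ Icc (-(R : ℤ)) R, (1 : ℝ) / s.natAbs := by
        rw [sum_add_distrib, ← mul_sum, sum_const, hcard, nsmul_eq_mul]; push_cast; ring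
    _ ≤ (2 * R + 1) * (2 * (1 + Real.log R)) + (2 * R + 1) * (2 * (1 + Real.log R)) := by
        have := sum_Icc_one_div_natAbs_le R
        gcongr
    _ = 4 * (2 * R + 1) * (1 + Real.log R) := by ring

/-- **The diagonal bound**:
`#{Δ = 0} ≤ 4 (2C₀ + 1) ((2R_M + 1) · 4 (2R_N + 1)(1 + log R_N) + (2R_N + 1)²)`.
[cite: FriedlanderIwaniecAnnals1998, proof of Lemma 5.1 ("The contribution of the diagonal")] -/
theorem card_diag_le (RM RN : ℕ) :
    (#((quintuples RM RN).filter fun x => det2 x.1.2.1 x.1.2.2 = 0) : ℝ) ≤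
      4 * (2 * cRange RM RN + 1) *
        ((2 * RM + 1) * (4 * (2 * RN + 1) * (1 + Real.log RN)) + (2 * RN + 1) ^ 2) := by
  set C := cRange RM RN with hC
  have hcardC : #(Icc (-(C : ℤ)) C) = 2 * C + 1 := by
    rw [Int.card_Icc]
    rw [show (C : ℤ) + 1 - -(C : ℤ) = ((2 * C + 1 : ℕ) : ℤ) by push_cast; ring, Int.toNat_natCast]
  -- the line counts
  have hline : ∀ z ∈ primBox RN, ∀ c : ℤ,
      (#(((intBox RM).filter (· ≠ 0)).filter fun w => reConj w z = c ^ 2) : ℝ) ≤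
        (2 * RM + 1 : ℝ) / max (z.1.natAbs : ℝ) z.2.natAbs + 1 := by
    intro z hz c
    have hprim : Int.gcd z.1 z.2 = 1 := (mem_primBox.mp hz).2
    have h := card_line_box_le hprim (c ^ 2) RM
    have hmax : ((max |z.1| |z.2| : ℤ) : ℝ) = max (z.1.natAbs : ℝ) z.2.natAbs := by
      simp only [Int.cast_max, Int.cast_abs, Nat.cast_natAbs]
    rw [hmax] at h
    refine le_trans ?_ h
    have hsub : (((intBox RM).filter (· ≠ 0)).filter fun w => reConj w z = c ^ 2) ⊆
        (intBox RM).filter fun uv : ℤ × ℤ => uv.1 * z.1 + uv.2 * z.2 = c ^ 2 := by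
      intro w hw
      simp only [mem_filter, reConj] at hw ⊢
      exact ⟨hw.1.1, hw.2⟩
    exact_mod_cast card_le_card hsub
  have hP : (#(triplesP RM RN) : ℝ) ≤ (2 * C + 1) *
      ((2 * RM + 1) * (4 * (2 * RN + 1) * (1 + Real.log RN)) + (2 * RN + 1) ^ 2) := by
    rw [card_triplesP_eq]
    push_cast
    calc ∑ z ∈ primBox RN, ∑ c ∈ Icc (-(C : ℤ)) C,
          (#(((intBox RM).filter (· ≠ 0)).filter fun w => reConj w z = c ^ 2) : ℝ)
        ≤ ∑ z ∈ primBox RN, ∑ c ∈ Icc (-(C : ℤ)) C,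
            ((2 * RM + 1 : ℝ) / max (z.1.natAbs : ℝ) z.2.natAbs + 1) :=
          sum_le_sum fun z hz => sum_le_sum fun c _ => hline z hz c
      _ = ∑ z ∈ primBox RN, ((2 * C + 1 : ℕ) : ℝ) *
            ((2 * RM + 1 : ℝ) / max (z.1.natAbs : ℝ) z.2.natAbs + 1) := by
          refine sum_congr rfl fun z _ => ?_
          rw [sum_const, hcardC, nsmul_eq_mul]
      _ = (2 * C + 1) * ((2 * RM + 1) * ∑ z ∈ primBox RN, (1 : ℝ) / max (z.1.natAbs : ℝ) z.2.natAbs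
            + #(primBox RN)) := by
          rw [← mul_sum, sum_add_distrib, sum_const, nsmul_eq_mul, mul_one, mul_sum]
          push_cast
          congr 1
          congr 1
          refine sum_congr rfl fun z _ => ?_
          ring
      _ ≤ (2 * C + 1) * ((2 * RM + 1) * (4 * (2 * RN + 1) * (1 + Real.log RN)) + (2 * RN + 1) ^ 2) := by
          have h1 : ∑ z ∈ primBox RN, (1 : ℝ) / max (z.1.natAbs : ℝ) z.2.natAbs ≤
              4 * (2 * RN + 1) * (1 + Real.log RN) :=
            (sum_le_sum_of_subset_of_nonneg (primBox_subset RN) fun _ _ _ => by positivity).trans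
              (sum_intBox_one_div_max_le RN)
          have h2 : (#(primBox RN) : ℝ) ≤ (2 * RN + 1) ^ 2 := by
            have := card_le_card (primBox_subset RN)
            rw [card_intBox] at this
            exact_mod_cast this
          gcongr
  calc (#((quintuples RM RN).filter fun x => det2 x.1.2.1 x.1.2.2 = 0) : ℝ)
      ≤ 4 * #(triplesP RM RN) := by exact_mod_cast card_diag_le_four_mul RM RN
    _ ≤ _ := by rw [mul_assoc]; exact mul_le_mul_of_nonneg_left hP (by norm_num)

/-! ### Off the diagonal: `w` is determined by `(z₁, z₂, c₁, c₂)` -/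

/-- `primBox` is symmetric under swapping the coordinates. [folklore] -/
theorem swap_mem_primBox {R : ℕ} {z : ℤ × ℤ} (h : z ∈ primBox R) : z.swap ∈ primBox R := by
  rw [mem_primBox] at h ⊢; exact ⟨swap_mem_intBox h.1, h.2.swap⟩

/-- `a(y) = c₁² s₂ - c₂² s₁` for `y = (z₁, (z₂, (c₁, c₂)))`, `z_i = (r_i, s_i)`.
[cite: FriedlanderIwaniecAnnals1998, proof of Lemma 5.1] -/
def aVal (y : (ℤ × ℤ) × (ℤ × ℤ) × (ℤ × ℤ)) : ℤ := y.2.2.1 ^ 2 * y.2.1.2 - y.2.2.2 ^ 2 * y.1.2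

/-- `b(y) = c₂² r₁ - c₁² r₂`. [cite: FriedlanderIwaniecAnnals1998, proof of Lemma 5.1] -/
def bVal (y : (ℤ × ℤ) × (ℤ × ℤ) × (ℤ × ℤ)) : ℤ := y.2.2.2 ^ 2 * y.1.1 - y.2.2.1 ^ 2 * y.2.1.1

/-- Cramer: `u Δ = c₁² s₂ - c₂² s₁` when `Re w̄ z_i = c_i²` (the source's `iΔw = c₁² z₂ - c₂² z₁`).
[cite: FriedlanderIwaniecAnnals1998, (6.3)-(6.4)] -/
theorem cramer_fst {w z₁ z₂ : ℤ × ℤ} {c₁ c₂ : ℤ} (h1 : reConj w z₁ = c₁ ^ 2)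
    (h2 : reConj w z₂ = c₂ ^ 2) : w.1 * det2 z₁ z₂ = c₁ ^ 2 * z₂.2 - c₂ ^ 2 * z₁.2 := by
  unfold reConj at h1 h2
  unfold det2
  linear_combination z₂.2 * h1 - z₁.2 * h2

/-- Cramer: `v Δ = c₂² r₁ - c₁² r₂`. [cite: FriedlanderIwaniecAnnals1998, (6.3)-(6.4)] -/
theorem cramer_snd {w z₁ z₂ : ℤ × ℤ} {c₁ c₂ : ℤ} (h1 : reConj w z₁ = c₁ ^ 2)
    (h2 : reConj w z₂ = c₂ ^ 2) : w.2 * det2 z₁ z₂ = c₂ ^ 2 * z₁.1 - c₁ ^ 2 * z₂.1 := by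
  unfold reConj at h1 h2
  unfold det2
  linear_combination z₁.1 * h2 - z₂.1 * h1

/-- The base set of the quadruples `(z₁, z₂, c₁, c₂)`. [folklore] -/
def baseY (RM RN : ℕ) : Finset ((ℤ × ℤ) × (ℤ × ℤ) × (ℤ × ℤ)) :=
  primBox RN ×ˢ (primBox RN ×ˢ intBox (cRange RM RN))

/-- `T_a`: `Δ ≠ 0`, `a ≠ 0`, `Δ ∣ a`. [cite: FriedlanderIwaniecAnnals1998, proof of Lemma 5.1] -/
def setTa (RM RN : ℕ) : Finset ((ℤ × ℤ) × (ℤ × ℤ) × (ℤ × ℤ)) :=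
  (baseY RM RN).filter fun y => det2 y.1 y.2.1 ≠ 0 ∧ aVal y ≠ 0 ∧ det2 y.1 y.2.1 ∣ aVal y

/-- `T_b`: `Δ ≠ 0`, `b ≠ 0`, `Δ ∣ b`. [cite: FriedlanderIwaniecAnnals1998, proof of Lemma 5.1] -/
def setTb (RM RN : ℕ) : Finset ((ℤ × ℤ) × (ℤ × ℤ) × (ℤ × ℤ)) :=
  (baseY RM RN).filter fun y => det2 y.1 y.2.1 ≠ 0 ∧ bVal y ≠ 0 ∧ det2 y.1 y.2.1 ∣ bVal y

/-- **Off the diagonal the quintuples inject into `T_a ∪ T_b`** by forgetting `w`.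
[cite: FriedlanderIwaniecAnnals1998, proof of Lemma 5.1] -/
theorem card_offdiag_le (RM RN : ℕ) :
    #((quintuples RM RN).filter fun x => det2 x.1.2.1 x.1.2.2 ≠ 0) ≤
      #(setTa RM RN) + #(setTb RM RN) := by
  set Q₁ := (quintuples RM RN).filter fun x => det2 x.1.2.1 x.1.2.2 ≠ 0 with hQ₁
  set prj : (((ℤ × ℤ) × (ℤ × ℤ) × (ℤ × ℤ)) × (ℤ × ℤ)) → ((ℤ × ℤ) × (ℤ × ℤ) × (ℤ × ℤ)) :=
    fun x => (x.1.2.1, (x.1.2.2, x.2)) with hprj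
  have hmem : ∀ x ∈ Q₁, (x.1.1 ∈ intBox RM ∧ x.1.1 ≠ 0) ∧ x.1.2.1 ∈ primBox RN ∧
      x.1.2.2 ∈ primBox RN ∧ x.2 ∈ intBox (cRange RM RN) ∧
      reConj x.1.1 x.1.2.1 = x.2.1 ^ 2 ∧ reConj x.1.1 x.1.2.2 = x.2.2 ^ 2 ∧
      det2 x.1.2.1 x.1.2.2 ≠ 0 := by
    intro x hx
    rw [hQ₁, mem_filter] at hx
    unfold quintuples at hx
    rw [mem_filter, mem_product, mem_product, mem_product, mem_filter] at hx
    tauto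
  have hinj : Set.InjOn prj Q₁ := by
    intro x hx x' hx' h
    obtain ⟨-, -, -, -, h1, h2, hΔ⟩ := hmem x hx
    obtain ⟨-, -, -, -, h1', h2', -⟩ := hmem x' hx'
    simp only [hprj, Prod.mk.injEq] at h
    obtain ⟨e1, e2, e3⟩ := h
    have hu : x.1.1.1 = x'.1.1.1 := by
      have a1 := cramer_fst h1 h2
      have a2 := cramer_fst h1' h2'
      rw [← e1, ← e2, ← e3] at a2
      exact mul_right_cancel₀ hΔ (a1.trans a2.symm)
    have hv : x.1.1.2 = x'.1.1.2 := by
      have a1 := cramer_snd h1 h2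
      have a2 := cramer_snd h1' h2'
      rw [← e1, ← e2, ← e3] at a2
      exact mul_right_cancel₀ hΔ (a1.trans a2.symm)
    exact Prod.ext (Prod.ext (Prod.ext hu hv) (Prod.ext e1 e2)) e3
  have himg : Q₁.image prj ⊆ setTa RM RN ∪ setTb RM RN := by
    intro y hy
    obtain ⟨x, hx, rfl⟩ := mem_image.mp hy
    obtain ⟨⟨-, hw0⟩, hz₁, hz₂, hc, h1, h2, hΔ⟩ := hmem x hx
    have hbase : prj x ∈ baseY RM RN := by
      simp only [baseY, hprj, mem_product]; exact ⟨hz₁, hz₂, hc⟩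
    have ha : x.1.1.1 * det2 x.1.2.1 x.1.2.2 = aVal (prj x) := by
      simp only [aVal, hprj]; exact cramer_fst h1 h2
    have hb : x.1.1.2 * det2 x.1.2.1 x.1.2.2 = bVal (prj x) := by
      simp only [bVal, hprj]; exact cramer_snd h1 h2
    rw [mem_union]
    by_cases hu : x.1.1.1 = 0
    · have hv : x.1.1.2 ≠ 0 := fun hv => hw0 (Prod.ext hu hv)
      right
      simp only [setTb, mem_filter]
      refine ⟨hbase, hΔ, ?_, ?_⟩
      · rw [← hb]; exact mul_ne_zero hv hΔ
      · rw [← hb]; exact Dvd.intro_left _ rfl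
    · left
      simp only [setTa, mem_filter]
      refine ⟨hbase, hΔ, ?_, ?_⟩
      · rw [← ha]; exact mul_ne_zero hu hΔ
      · rw [← ha]; exact Dvd.intro_left _ rfl
  calc #Q₁ = #(Q₁.image prj) := (card_image_of_injOn hinj).symm
    _ ≤ #(setTa RM RN ∪ setTb RM RN) := card_le_card himg
    _ ≤ #(setTa RM RN) + #(setTb RM RN) := card_union_le _ _

/-- **`#T_b ≤ #T_a`** by swapping the coordinates of `z₁, z₂` (`Δ ↦ -Δ`, `a ↦ -b`).
[cite: FriedlanderIwaniecAnnals1998, proof of Lemma 5.1 ("By symmetry")] -/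
theorem card_setTb_le (RM RN : ℕ) : #(setTb RM RN) ≤ #(setTa RM RN) := by
  set swp : ((ℤ × ℤ) × (ℤ × ℤ) × (ℤ × ℤ)) → ((ℤ × ℤ) × (ℤ × ℤ) × (ℤ × ℤ)) :=
    fun y => (y.1.swap, (y.2.1.swap, y.2.2)) with hswp
  refine card_le_card_of_injOn swp ?_ ?_
  · intro y hy
    rw [mem_coe, setTb, mem_filter, baseY, mem_product, mem_product] at hy
    obtain ⟨⟨hz₁, hz₂, hc⟩, hΔ, hb, hdvd⟩ := hy
    have hΔ' : det2 (swp y).1 (swp y).2.1 = -det2 y.1 y.2.1 := by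
      simp only [hswp, det2, Prod.fst_swap, Prod.snd_swap]; ring
    have ha' : aVal (swp y) = -bVal y := by
      simp only [hswp, aVal, bVal, Prod.snd_swap]; ring
    rw [mem_coe, setTa, mem_filter, baseY, mem_product, mem_product, hΔ', ha']
    exact ⟨⟨swap_mem_primBox hz₁, swap_mem_primBox hz₂, hc⟩, neg_ne_zero.mpr hΔ,
      neg_ne_zero.mpr hb, neg_dvd.mpr (dvd_neg.mpr hdvd)⟩
  · intro y _ y' _ h
    simp only [hswp, Prod.mk.injEq] at h
    obtain ⟨h1, h2, h3⟩ := h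
    exact Prod.ext (Prod.swap_injective h1) (Prod.ext (Prod.swap_injective h2) h3)

/-- `T_a'`: `T_a` with `|s₂| ≤ |s₁|`. [cite: FriedlanderIwaniecAnnals1998, proof of Lemma 5.1] -/
def setTa' (RM RN : ℕ) : Finset ((ℤ × ℤ) × (ℤ × ℤ) × (ℤ × ℤ)) :=
  (setTa RM RN).filter fun y => y.2.1.2.natAbs ≤ y.1.2.natAbs

/-- **`#T_a ≤ 2 #T_a'`** by the symmetry `(z₁, c₁) ↔ (z₂, c₂)` (`Δ ↦ -Δ`, `a ↦ -a`).
[cite: FriedlanderIwaniecAnnals1998, proof of Lemma 5.1 ("By symmetry")] -/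
theorem card_setTa_le (RM RN : ℕ) : #(setTa RM RN) ≤ 2 * #(setTa' RM RN) := by
  set p : ((ℤ × ℤ) × (ℤ × ℤ) × (ℤ × ℤ)) → Prop := fun y => y.2.1.2.natAbs ≤ y.1.2.natAbs with hp
  have hsplit := Finset.card_filter_add_card_filter_not (s := setTa RM RN) p
  set ι : ((ℤ × ℤ) × (ℤ × ℤ) × (ℤ × ℤ)) → ((ℤ × ℤ) × (ℤ × ℤ) × (ℤ × ℤ)) :=
    fun y => (y.2.1, (y.1, y.2.2.swap)) with hι
  have hle : #((setTa RM RN).filter fun y => ¬ p y) ≤ #(setTa' RM RN) := by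
    refine card_le_card_of_injOn ι ?_ ?_
    · intro y hy
      rw [mem_coe, mem_filter, setTa, mem_filter, baseY, mem_product, mem_product] at hy
      obtain ⟨⟨⟨hz₁, hz₂, hc⟩, hΔ, ha, hdvd⟩, hnp⟩ := hy
      have hΔ' : det2 (ι y).1 (ι y).2.1 = -det2 y.1 y.2.1 := by
        simp only [hι, det2]; ring
      have ha' : aVal (ι y) = -aVal y := by
        simp only [hι, aVal, Prod.fst_swap, Prod.snd_swap]; ring
      rw [mem_coe, setTa', mem_filter, setTa, mem_filter, baseY, mem_product, mem_product, hΔ', ha']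
      refine ⟨⟨⟨hz₂, hz₁, swap_mem_intBox hc⟩, neg_ne_zero.mpr hΔ, neg_ne_zero.mpr ha,
        neg_dvd.mpr (dvd_neg.mpr hdvd)⟩, ?_⟩
      simp only [hι, hp] at hnp ⊢
      omega
    · intro y _ y' _ h
      simp only [hι, Prod.mk.injEq] at h
      obtain ⟨h1, h2, h3⟩ := h
      exact Prod.ext h2 (Prod.ext h1 (Prod.swap_injective h3))
  have : #((setTa RM RN).filter p) = #(setTa' RM RN) := rfl
  omega

/-- The set `U`: coordinates `(((s₁, s₂), (c₁, c₂)), (r₁, r₂))`, all in boxes, with `|s₂| ≤ |s₁|`,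
`a = c₁² s₂ - c₂² s₁ ≠ 0`, `Δ = r₁ s₂ - r₂ s₁ ≠ 0`, `Δ ∣ a` (primitivity dropped).
[cite: FriedlanderIwaniecAnnals1998, proof of Lemma 5.1] -/
def setU (RM RN : ℕ) : Finset ((((ℤ × ℤ) × (ℤ × ℤ)) × (ℤ × ℤ))) :=
  (((Icc (-(RN : ℤ)) RN ×ˢ Icc (-(RN : ℤ)) RN) ×ˢ intBox (cRange RM RN)) ×ˢ intBox RN).filter
    fun u => u.1.1.2.natAbs ≤ u.1.1.1.natAbs ∧
      u.1.2.1 ^ 2 * u.1.1.2 - u.1.2.2 ^ 2 * u.1.1.1 ≠ 0 ∧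
      u.2.1 * u.1.1.2 - u.2.2 * u.1.1.1 ≠ 0 ∧
      u.2.1 * u.1.1.2 - u.2.2 * u.1.1.1 ∣ u.1.2.1 ^ 2 * u.1.1.2 - u.1.2.2 ^ 2 * u.1.1.1

/-- **`#T_a' ≤ #U`** (re-coordinatisation, forgetting primitivity). [folklore] -/
theorem card_setTa'_le (RM RN : ℕ) : #(setTa' RM RN) ≤ #(setU RM RN) := by
  set ρ : ((ℤ × ℤ) × (ℤ × ℤ) × (ℤ × ℤ)) → (((ℤ × ℤ) × (ℤ × ℤ)) × (ℤ × ℤ)) :=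
    fun y => (((y.1.2, y.2.1.2), y.2.2), (y.1.1, y.2.1.1)) with hρ
  refine card_le_card_of_injOn ρ ?_ ?_
  · intro y hy
    rw [mem_coe, setTa', mem_filter, setTa, mem_filter, baseY, mem_product, mem_product] at hy
    obtain ⟨⟨⟨hz₁, hz₂, hc⟩, hΔ, ha, hdvd⟩, hp⟩ := hy
    have hr₁ := (mem_intBox.mp (primBox_subset RN hz₁))
    have hr₂ := (mem_intBox.mp (primBox_subset RN hz₂))
    have hΔ' : y.1.1 * y.2.1.2 - y.2.1.1 * y.1.2 = det2 y.1 y.2.1 := rfl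
    have ha' : y.2.2.1 ^ 2 * y.2.1.2 - y.2.2.2 ^ 2 * y.1.2 = aVal y := rfl
    rw [mem_coe, setU, mem_filter, mem_product, mem_product, mem_product]
    simp only [hρ]
    refine ⟨⟨⟨⟨mem_Icc.mpr hr₁.2, mem_Icc.mpr hr₂.2⟩, hc⟩, mem_intBox.mpr ⟨hr₁.1, hr₂.1⟩⟩, hp, ?_, ?_, ?_⟩
    · rw [ha']; exact ha
    · rw [hΔ']; exact hΔ
    · rw [hΔ', ha']; exact hdvd
  · intro y _ y' _ h
    simp only [hρ, Prod.mk.injEq] at h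
    obtain ⟨⟨⟨h1, h2⟩, h3⟩, h4, h5⟩ := h
    exact Prod.ext (Prod.ext h4 h1) (Prod.ext (Prod.ext h5 h2) h3)

/-- `#U` fibred over `(s₁, s₂, c₁, c₂)`. [folklore] -/
theorem card_setU_eq (RM RN : ℕ) : #(setU RM RN) =
    ∑ sc ∈ (Icc (-(RN : ℤ)) RN ×ˢ Icc (-(RN : ℤ)) RN) ×ˢ intBox (cRange RM RN),
      #((intBox RN).filter fun r : ℤ × ℤ =>
        sc.1.2.natAbs ≤ sc.1.1.natAbs ∧ sc.2.1 ^ 2 * sc.1.2 - sc.2.2 ^ 2 * sc.1.1 ≠ 0 ∧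
        r.1 * sc.1.2 - r.2 * sc.1.1 ≠ 0 ∧
        r.1 * sc.1.2 - r.2 * sc.1.1 ∣ sc.2.1 ^ 2 * sc.1.2 - sc.2.2 ^ 2 * sc.1.1) := by
  unfold setU
  rw [card_filter, sum_product]
  refine sum_congr rfl fun sc _ => ?_
  rw [card_filter]

/-- **The `(r₁, r₂)` with `Δ ≠ 0`, `Δ ∣ a`** are at most `2 τ(|a|) ((2R + 1)(s₁, s₂)/|s₁| + 1)`
(enumerate `Δ = ±e`, `e ∣ |a|`, and use `card_det_box_le`). [cite: FriedlanderIwaniecAnnals1998, proof of Lemma 5.1] -/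
theorem card_r_le {s₁ : ℤ} (hs₁ : s₁ ≠ 0) (s₂ : ℤ) {a : ℤ} (ha : a ≠ 0) (R : ℕ) :
    (#((intBox R).filter fun r : ℤ × ℤ =>
        r.1 * s₂ - r.2 * s₁ ≠ 0 ∧ r.1 * s₂ - r.2 * s₁ ∣ a) : ℝ) ≤
      2 * (a.natAbs.divisors.card : ℝ) * ((2 * R + 1 : ℝ) * Int.gcd s₁ s₂ / |s₁| + 1) := by
  set S := (intBox R).filter fun r : ℤ × ℤ => r.1 * s₂ - r.2 * s₁ ≠ 0 ∧ r.1 * s₂ - r.2 * s₁ ∣ a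
    with hS
  set F : ℤ → Finset (ℤ × ℤ) := fun e => (intBox R).filter fun r : ℤ × ℤ => r.1 * s₂ - r.2 * s₁ = e
    with hF
  have hsub : S ⊆ a.natAbs.divisors.biUnion fun e : ℕ => F e ∪ F (-(e : ℤ)) := by
    intro r hr
    rw [hS, mem_filter] at hr
    obtain ⟨hr, hΔ0, hdvd⟩ := hr
    set Δ := r.1 * s₂ - r.2 * s₁ with hΔ
    rw [mem_biUnion]
    refine ⟨Δ.natAbs, Nat.mem_divisors.mpr ⟨Int.natAbs_dvd_natAbs.mpr hdvd, Int.natAbs_ne_zero.mpr ha⟩, ?_⟩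
    rw [mem_union]
    rcases Int.natAbs_eq Δ with h | h
    · left; rw [hF, mem_filter]; exact ⟨hr, h⟩
    · right; rw [hF, mem_filter]; exact ⟨hr, h⟩
  have hw : ∀ e : ℤ, (#(F e) : ℝ) ≤ (2 * R + 1 : ℝ) * Int.gcd s₁ s₂ / |s₁| + 1 := fun e => by
    rw [hF]; exact card_det_box_le hs₁ s₂ e R
  calc (#S : ℝ) ≤ #(a.natAbs.divisors.biUnion fun e : ℕ => F e ∪ F (-(e : ℤ))) := by
        exact_mod_cast card_le_card hsub
    _ ≤ ∑ e ∈ a.natAbs.divisors, (#(F e ∪ F (-(e : ℤ))) : ℝ) := by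
        exact_mod_cast card_biUnion_le
    _ ≤ ∑ e ∈ a.natAbs.divisors, ((#(F e) : ℝ) + #(F (-(e : ℤ)))) := by
        refine sum_le_sum fun e _ => ?_
        exact_mod_cast card_union_le _ _
    _ ≤ ∑ e ∈ a.natAbs.divisors, 2 * ((2 * R + 1 : ℝ) * Int.gcd s₁ s₂ / |s₁| + 1) := by
        refine sum_le_sum fun e _ => ?_
        have h1 := hw e
        have h2 := hw (-(e : ℤ))
        linarith
    _ = 2 * (a.natAbs.divisors.card : ℝ) * ((2 * R + 1 : ℝ) * Int.gcd s₁ s₂ / |s₁| + 1) := by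
        rw [sum_const, nsmul_eq_mul]; ring

/-- Integers in `[-C, C]` with a given residue modulo `d ≥ 1`: at most `2C/d + 1`. [folklore] -/
theorem card_Icc_filter_emod_le {d : ℕ} (hd : 0 < d) (C : ℕ) (x : ℕ) :
    #((Icc (-(C : ℤ)) C).filter fun t : ℤ => (t % d).toNat = x) ≤ 2 * C / d + 1 := by
  refine card_le_of_congr hd (lo := -(C : ℤ)) (ℓ := 2 * C) ?_ ?_
  · intro t ht
    rw [mem_filter, mem_Icc] at ht
    exact ⟨ht.1.1, by push_cast; linarith [ht.1.2]⟩
  · intro t ht t' ht'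
    rw [mem_filter] at ht ht'
    have hd0 : (0 : ℤ) < d := by exact_mod_cast hd
    have h1 : t % d = t' % d := by
      have e1 : ((t % d).toNat : ℤ) = t % d := Int.toNat_of_nonneg (Int.emod_nonneg _ hd0.ne')
      have e2 : ((t' % d).toNat : ℤ) = t' % d := Int.toNat_of_nonneg (Int.emod_nonneg _ hd0.ne')
      rw [← e1, ← e2, ht.2, ht'.2]
    have h2 : t' ≡ t [ZMOD d] := h1.symm
    exact (Int.ModEq.dvd h2.symm) |> fun h => by
      -- `Int.ModEq.dvd : a ≡ b [ZMOD n] → n ∣ b - a`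
      have := Int.ModEq.dvd h2
      simpa using this

/-- **The `(c₁, c₂)` in the box in residue classes**:
`#{(c₁, c₂) ∈ [-C, C]² : d ∣ s₂ c₁² - s₁ c₂²} ≤ (2C/d + 1)² N(s₂, s₁; d)`.
[cite: FriedlanderIwaniecAnnals1998, proof of Lemma 5.1] -/
theorem card_cbox_dvd_le {d : ℕ} (hd : 0 < d) (C : ℕ) (s₁ s₂ : ℤ) :
    #((intBox C).filter fun c : ℤ × ℤ => (d : ℤ) ∣ s₂ * c.1 ^ 2 - s₁ * c.2 ^ 2) ≤
      (2 * C / d + 1) ^ 2 * quadCongrCount d s₂ s₁ := by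
  set S := (intBox C).filter fun c : ℤ × ℤ => (d : ℤ) ∣ s₂ * c.1 ^ 2 - s₁ * c.2 ^ 2 with hS
  set φ : ℤ × ℤ → ℕ × ℕ := fun c => ((c.1 % d).toNat, (c.2 % d).toNat) with hφ
  have hd0 : (0 : ℤ) < d := by exact_mod_cast hd
  have hres : ∀ t : ℤ, ((t % d).toNat : ℤ) = t % d ∧ (t % d).toNat < d ∧
      ((t % d).toNat : ℤ) ≡ t [ZMOD d] := by
    intro t
    have e1 : ((t % d).toNat : ℤ) = t % d := Int.toNat_of_nonneg (Int.emod_nonneg _ hd0.ne')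
    refine ⟨e1, ?_, ?_⟩
    · have : ((t % d).toNat : ℤ) < d := by rw [e1]; exact Int.emod_lt_of_pos _ hd0
      exact_mod_cast this
    · rw [e1]; exact Int.mod_modEq _ _
  have himg : S.image φ ⊆ ((range d) ×ˢ (range d)).filter
      fun xy : ℕ × ℕ => (d : ℤ) ∣ s₂ * (xy.1 : ℤ) ^ 2 - s₁ * (xy.2 : ℤ) ^ 2 := by
    intro xy hxy
    obtain ⟨c, hc, rfl⟩ := mem_image.mp hxy
    rw [hS, mem_filter] at hc
    obtain ⟨e1, l1, m1⟩ := hres c.1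
    obtain ⟨e2, l2, m2⟩ := hres c.2
    simp only [hφ, mem_filter, mem_product, mem_range]
    refine ⟨⟨l1, l2⟩, ?_⟩
    have hmod : s₂ * ((c.1 % d).toNat : ℤ) ^ 2 - s₁ * ((c.2 % d).toNat : ℤ) ^ 2 ≡
        s₂ * c.1 ^ 2 - s₁ * c.2 ^ 2 [ZMOD d] :=
      ((m1.pow 2).mul_left s₂).sub ((m2.pow 2).mul_left s₁)
    exact Int.modEq_zero_iff_dvd.mp (hmod.trans (Int.modEq_zero_iff_dvd.mpr hc.2))
  have hfib : ∀ xy ∈ S.image φ, #(S.filter fun c => φ c = xy) ≤ (2 * C / d + 1) ^ 2 := by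
    intro xy _
    have hsub : (S.filter fun c => φ c = xy) ⊆
        ((Icc (-(C : ℤ)) C).filter fun t : ℤ => (t % d).toNat = xy.1) ×ˢ
          ((Icc (-(C : ℤ)) C).filter fun t : ℤ => (t % d).toNat = xy.2) := by
      intro c hc
      rw [mem_filter, hS, mem_filter] at hc
      obtain ⟨⟨hcbox, -⟩, hcφ⟩ := hc
      have hc1 := (mem_intBox.mp hcbox)
      subst hcφ
      rw [mem_product, mem_filter, mem_filter, mem_Icc, mem_Icc]
      exact ⟨⟨hc1.1, rfl⟩, ⟨hc1.2, rfl⟩⟩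
    calc #(S.filter fun c => φ c = xy)
        ≤ #(((Icc (-(C : ℤ)) C).filter fun t : ℤ => (t % d).toNat = xy.1) ×ˢ
            ((Icc (-(C : ℤ)) C).filter fun t : ℤ => (t % d).toNat = xy.2)) := card_le_card hsub
      _ ≤ (2 * C / d + 1) * (2 * C / d + 1) := by
          rw [card_product]
          exact Nat.mul_le_mul (card_Icc_filter_emod_le hd C xy.1) (card_Icc_filter_emod_le hd C xy.2)
      _ = (2 * C / d + 1) ^ 2 := (sq _).symm
  calc #S ≤ (2 * C / d + 1) ^ 2 * #(S.image φ) := card_le_mul_card_image _ _ hfib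
    _ ≤ (2 * C / d + 1) ^ 2 * quadCongrCount d s₂ s₁ := by
        rw [quadCongrCount_def]
        exact Nat.mul_le_mul_left _ (card_le_card himg)

/-! ### The divisor sums of the off-diagonal count -/

/-- `a = c₁² s₂ - c₂² s₁` as a function of `s = (s₁, s₂)` and `c = (c₁, c₂)`.
[cite: FriedlanderIwaniecAnnals1998, proof of Lemma 5.1] -/
def aOf (s c : ℤ × ℤ) : ℤ := c.1 ^ 2 * s.2 - c.2 ^ 2 * s.1

/-- `Στ(s) = ∑_{c ∈ [-C, C]², a ≠ 0} τ(|a|)`, `a = c₁² s₂ - c₂² s₁`. [cite: FriedlanderIwaniecAnnals1998, proof of Lemma 5.1] -/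
def tauSum (Cb : ℕ) (s : ℤ × ℤ) : ℝ :=
  ∑ c ∈ intBox Cb, if aOf s c ≠ 0 then (((aOf s c).natAbs.divisors.card : ℕ) : ℝ) else 0

/-- `Στ(s) ≥ 0`. [folklore] -/
theorem tauSum_nonneg (Cb : ℕ) (s : ℤ × ℤ) : 0 ≤ tauSum Cb s :=
  sum_nonneg fun _ _ => by split_ifs <;> positivity

/-- The weight `w(s) = (2R + 1)(s₁, s₂)/|s₁| + 1` of `card_det_box_le`. [folklore] -/
def wWeight (R : ℕ) (s : ℤ × ℤ) : ℝ := (2 * R + 1 : ℝ) * Int.gcd s.1 s.2 / ((|s.1| : ℤ) : ℝ) + 1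

/-- `w(s) ≥ 0`. [folklore] -/
theorem wWeight_nonneg (R : ℕ) (s : ℤ × ℤ) : 0 ≤ wWeight R s := by
  unfold wWeight
  have : (0 : ℝ) ≤ ((|s.1| : ℤ) : ℝ) := by exact_mod_cast abs_nonneg s.1
  positivity

/-- **`#U ≤ 2 ∑_{|s₂| ≤ |s₁|} w(s) Στ(s)`** (`card_r_le` in each fibre).
[cite: FriedlanderIwaniecAnnals1998, proof of Lemma 5.1] -/
theorem card_setU_le (RM RN : ℕ) :
    (#(setU RM RN) : ℝ) ≤ 2 * ∑ s ∈ (Icc (-(RN : ℤ)) RN ×ˢ Icc (-(RN : ℤ)) RN).filter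
      (fun s => s.2.natAbs ≤ s.1.natAbs), wWeight RN s * tauSum (cRange RM RN) s := by
  rw [card_setU_eq]
  push_cast
  rw [sum_product, mul_sum, sum_filter]
  refine sum_le_sum fun s hs => ?_
  split_ifs with hp
  · -- the fibre sum over `c`
    unfold tauSum aOf
    rw [mul_sum, mul_sum]
    refine sum_le_sum fun c _ => ?_
    split_ifs with ha
    · have hs₁ : s.1 ≠ 0 := by
        intro h0
        have : s.2.natAbs = 0 := by rw [h0] at hp; simpa using hp
        rw [Int.natAbs_eq_zero] at this
        apply ha; rw [h0, this]; ring
      have h := card_r_le hs₁ s.2 ha RN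
      have hfilt : ((intBox RN).filter fun r : ℤ × ℤ =>
          s.2.natAbs ≤ s.1.natAbs ∧ c.1 ^ 2 * s.2 - c.2 ^ 2 * s.1 ≠ 0 ∧
          r.1 * s.2 - r.2 * s.1 ≠ 0 ∧ r.1 * s.2 - r.2 * s.1 ∣ c.1 ^ 2 * s.2 - c.2 ^ 2 * s.1) =
          (intBox RN).filter fun r : ℤ × ℤ =>
            r.1 * s.2 - r.2 * s.1 ≠ 0 ∧ r.1 * s.2 - r.2 * s.1 ∣ c.1 ^ 2 * s.2 - c.2 ^ 2 * s.1 := by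
        refine filter_congr fun r _ => ?_
        constructor
        · rintro ⟨-, -, h1, h2⟩; exact ⟨h1, h2⟩
        · rintro ⟨h1, h2⟩; exact ⟨hp, ha, h1, h2⟩
      rw [hfilt]
      calc (#((intBox RN).filter fun r : ℤ × ℤ =>
            r.1 * s.2 - r.2 * s.1 ≠ 0 ∧ r.1 * s.2 - r.2 * s.1 ∣ c.1 ^ 2 * s.2 - c.2 ^ 2 * s.1) : ℝ)
          ≤ 2 * ((c.1 ^ 2 * s.2 - c.2 ^ 2 * s.1).natAbs.divisors.card : ℝ) *
              ((2 * RN + 1 : ℝ) * Int.gcd s.1 s.2 / |s.1| + 1) := h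
        _ = 2 * (wWeight RN s * ((c.1 ^ 2 * s.2 - c.2 ^ 2 * s.1).natAbs.divisors.card : ℝ)) := by
            unfold wWeight; ring
    · have hempty : ((intBox RN).filter fun r : ℤ × ℤ =>
          s.2.natAbs ≤ s.1.natAbs ∧ c.1 ^ 2 * s.2 - c.2 ^ 2 * s.1 ≠ 0 ∧
          r.1 * s.2 - r.2 * s.1 ≠ 0 ∧ r.1 * s.2 - r.2 * s.1 ∣ c.1 ^ 2 * s.2 - c.2 ^ 2 * s.1) = ∅ :=
        filter_eq_empty_iff.mpr fun r _ h => ha h.2.1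
      rw [hempty, card_empty]; simp
  · have hzero : ∀ c ∈ intBox (cRange RM RN), ((#((intBox RN).filter fun r : ℤ × ℤ =>
        s.2.natAbs ≤ s.1.natAbs ∧ c.1 ^ 2 * s.2 - c.2 ^ 2 * s.1 ≠ 0 ∧
        r.1 * s.2 - r.2 * s.1 ≠ 0 ∧ r.1 * s.2 - r.2 * s.1 ∣ c.1 ^ 2 * s.2 - c.2 ^ 2 * s.1) : ℕ) : ℝ) = 0 := by
      intro c _
      rw [filter_eq_empty_iff.mpr fun r _ h => hp h.1, card_empty, Nat.cast_zero]
    rw [sum_congr rfl hzero, sum_const_zero]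

/-- `∑_{-n ≤ t ≤ n} τ(|t|)^r ≤ 2 ∑_{1 ≤ k ≤ n} τ(k)^r` for `r ≥ 1` (`τ(0) = 0`). [folklore] -/
theorem sum_Icc_tau_natAbs_pow_le {r : ℕ} (hr : 1 ≤ r) (n : ℕ) :
    ∑ t ∈ Icc (-(n : ℤ)) n, ((σ 0 t.natAbs : ℕ) : ℝ) ^ r ≤ 2 * ∑ k ∈ Icc 1 n, ((σ 0 k : ℕ) : ℝ) ^ r := by
  rw [sum_comp (fun k : ℕ => ((σ 0 k : ℕ) : ℝ) ^ r) Int.natAbs]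
  have hfib : ∀ k ∈ (Icc (-(n : ℤ)) n).image Int.natAbs,
      #((Icc (-(n : ℤ)) n).filter fun t => t.natAbs = k) ≤ 2 := by
    intro k _
    calc #((Icc (-(n : ℤ)) n).filter fun t => t.natAbs = k)
        ≤ #({(k : ℤ), -(k : ℤ)} : Finset ℤ) := by
          refine card_le_card fun t ht => ?_
          rw [mem_filter] at ht
          rcases Int.natAbs_eq t with h | h <;> rw [ht.2] at h <;> simp [h]
      _ ≤ 2 := card_insert_le _ _ |>.trans (by rw [card_singleton])
  have himg : (Icc (-(n : ℤ)) n).image Int.natAbs ⊆ Icc 0 n := by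
    intro k hk
    obtain ⟨t, ht, rfl⟩ := mem_image.mp hk
    rw [mem_Icc] at ht ⊢
    refine ⟨Nat.zero_le _, ?_⟩
    have : (t.natAbs : ℤ) ≤ n := by rw [Int.natCast_natAbs]; exact abs_le.mpr ht
    exact_mod_cast this
  have h0 : ((σ 0 (0 : ℕ) : ℕ) : ℝ) ^ r = 0 := by
    rw [ArithmeticFunction.map_zero, Nat.cast_zero, zero_pow (by omega)]
  calc ∑ k ∈ (Icc (-(n : ℤ)) n).image Int.natAbs,
        #((Icc (-(n : ℤ)) n).filter fun t => t.natAbs = k) • (((σ 0 k : ℕ) : ℝ) ^ r)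
      ≤ ∑ k ∈ (Icc (-(n : ℤ)) n).image Int.natAbs, (2 : ℝ) * (((σ 0 k : ℕ) : ℝ) ^ r) := by
        refine sum_le_sum fun k hk => ?_
        rw [nsmul_eq_mul]
        exact mul_le_mul_of_nonneg_right (by exact_mod_cast hfib k hk) (by positivity)
    _ ≤ ∑ k ∈ Icc 0 n, (2 : ℝ) * (((σ 0 k : ℕ) : ℝ) ^ r) :=
        sum_le_sum_of_subset_of_nonneg himg fun _ _ _ => by positivity
    _ = 2 * ∑ k ∈ Icc 1 n, ((σ 0 k : ℕ) : ℝ) ^ r := by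
        rw [← mul_sum, show Icc 0 n = insert 0 (Icc 1 n) by
          rw [show (Icc 1 n : Finset ℕ) = Ioc 0 n from Finset.Icc_add_one_left_eq_Ioc 0 n,
            Finset.Ioc_insert_left (Nat.zero_le n)], sum_insert (by simp), h0, zero_add]

/-- `τ(x² y) ≤ τ(x)² τ(y)`. [folklore] -/
theorem sigma_zero_sq_mul_le (x y : ℕ) : σ 0 (x ^ 2 * y) ≤ σ 0 x ^ 2 * σ 0 y := by
  calc σ 0 (x ^ 2 * y) ≤ σ 0 (x ^ 2) * σ 0 y := sigma_zero_mul_le _ _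
    _ ≤ (σ 0 x * σ 0 x) * σ 0 y := by
        refine Nat.mul_le_mul_right _ ?_; rw [sq]; exact sigma_zero_mul_le _ _
    _ = σ 0 x ^ 2 * σ 0 y := by rw [sq]

/-- **The terms `s₂ = 0`**: `Στ(s₁, 0) ≤ (2C + 1) τ(|s₁|) ∑_{|c₂| ≤ C} τ(|c₂|)²`
(`a = -c₂² s₁`, `τ(c₂² |s₁|) ≤ τ(|c₂|)² τ(|s₁|)`). [cite: FriedlanderIwaniecAnnals1998, proof of Lemma 5.1] -/
theorem tauSum_snd_zero_le (Cb : ℕ) (s₁ : ℤ) :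
    tauSum Cb (s₁, 0) ≤ (2 * Cb + 1) * ((σ 0 s₁.natAbs : ℕ) : ℝ) *
      ∑ c₂ ∈ Icc (-(Cb : ℤ)) Cb, ((σ 0 c₂.natAbs : ℕ) : ℝ) ^ 2 := by
  have hcard : #(Icc (-(Cb : ℤ)) Cb) = 2 * Cb + 1 := by
    rw [Int.card_Icc]
    rw [show (Cb : ℤ) + 1 - -(Cb : ℤ) = ((2 * Cb + 1 : ℕ) : ℤ) by push_cast; ring, Int.toNat_natCast]
  unfold tauSum aOf
  calc ∑ c ∈ intBox Cb, (if c.1 ^ 2 * (s₁, (0 : ℤ)).2 - c.2 ^ 2 * (s₁, (0 : ℤ)).1 ≠ 0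
        then (((c.1 ^ 2 * (s₁, (0 : ℤ)).2 - c.2 ^ 2 * (s₁, (0 : ℤ)).1).natAbs.divisors.card : ℕ) : ℝ)
        else 0)
      ≤ ∑ c ∈ intBox Cb, ((σ 0 s₁.natAbs : ℕ) : ℝ) * ((σ 0 c.2.natAbs : ℕ) : ℝ) ^ 2 := by
        refine sum_le_sum fun c _ => ?_
        split_ifs with h
        · simp only
          have hnat : (c.1 ^ 2 * 0 - c.2 ^ 2 * s₁).natAbs = c.2.natAbs ^ 2 * s₁.natAbs := by
            rw [mul_zero, zero_sub, Int.natAbs_neg, Int.natAbs_mul, Int.natAbs_pow]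
          rw [hnat, ← ArithmeticFunction.sigma_zero_apply]
          have := sigma_zero_sq_mul_le c.2.natAbs s₁.natAbs
          calc ((σ 0 (c.2.natAbs ^ 2 * s₁.natAbs) : ℕ) : ℝ)
              ≤ ((σ 0 c.2.natAbs ^ 2 * σ 0 s₁.natAbs : ℕ) : ℝ) := by exact_mod_cast this
            _ = ((σ 0 s₁.natAbs : ℕ) : ℝ) * ((σ 0 c.2.natAbs : ℕ) : ℝ) ^ 2 := by push_cast; ring
        · positivity
    _ = (2 * Cb + 1) * ((σ 0 s₁.natAbs : ℕ) : ℝ) *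
          ∑ c₂ ∈ Icc (-(Cb : ℤ)) Cb, ((σ 0 c₂.natAbs : ℕ) : ℝ) ^ 2 := by
        unfold intBox
        rw [sum_product]
        simp only
        rw [sum_const, hcard, nsmul_eq_mul, mul_sum, mul_sum]
        push_cast
        refine sum_congr rfl fun c₂ _ => ?_
        ring

/-- `|a| ≤ 2 C² R` on the boxes. [folklore] -/
theorem natAbs_aOf_le {Cb RN : ℕ} {s : ℤ × ℤ} (hs1 : s.1.natAbs ≤ RN) (hs2 : s.2.natAbs ≤ RN)
    {c : ℤ × ℤ} (hc : c ∈ intBox Cb) : (aOf s c).natAbs ≤ 2 * Cb ^ 2 * RN := by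
  obtain ⟨h1, h2⟩ := abs_le_of_mem_intBox hc
  have h1' : c.1.natAbs ≤ Cb := by
    have : (c.1.natAbs : ℤ) ≤ Cb := by rw [Int.natCast_natAbs]; exact h1
    exact_mod_cast this
  have h2' : c.2.natAbs ≤ Cb := by
    have : (c.2.natAbs : ℤ) ≤ Cb := by rw [Int.natCast_natAbs]; exact h2
    exact_mod_cast this
  unfold aOf
  calc (c.1 ^ 2 * s.2 - c.2 ^ 2 * s.1).natAbs
      ≤ (c.1 ^ 2 * s.2).natAbs + (c.2 ^ 2 * s.1).natAbs := Int.natAbs_sub_le _ _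
    _ = c.1.natAbs ^ 2 * s.2.natAbs + c.2.natAbs ^ 2 * s.1.natAbs := by
        rw [Int.natAbs_mul, Int.natAbs_mul, Int.natAbs_pow, Int.natAbs_pow]
    _ ≤ Cb ^ 2 * RN + Cb ^ 2 * RN := by gcongr
    _ = 2 * Cb ^ 2 * RN := by ring

/-- **Landreau's inequality summed over the box and the order of summation exchanged**:
`Στ(s) ≤ K_L ∑_{d ≤ Y} τ(d)^{M_L} #{c ∈ [-C, C]² : d ∣ s₂ c₁² - s₁ c₂²}`, `Y = (2C²R + 1)^{1/4}`.
[cite: FriedlanderIwaniecAnnals1998, proof of Lemma 5.1 ("By Lemma 2.2 with k = 4 …")] -/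
theorem tauSum_le_landreau {KL : ℝ} {ML : ℕ} (hKL : 0 < KL)
    (hL : ∀ n : ℕ, n ≠ 0 → ∀ y : ℝ, (n : ℝ) ^ (1 / 4 : ℝ) ≤ y →
      (n.divisors.card : ℝ) ≤
        KL * ∑ d ∈ n.divisors, if (d : ℝ) ≤ y then ((d.divisors.card : ℕ) : ℝ) ^ ML else 0)
    (Cb RN : ℕ) {s : ℤ × ℤ} (hs1 : s.1.natAbs ≤ RN) (hs2 : s.2.natAbs ≤ RN) :
    tauSum Cb s ≤ KL * ∑ d ∈ Icc 1 ⌊((2 * Cb ^ 2 * RN + 1 : ℕ) : ℝ) ^ (1 / 4 : ℝ)⌋₊,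
      ((d.divisors.card : ℕ) : ℝ) ^ ML *
        #((intBox Cb).filter fun c : ℤ × ℤ => (d : ℤ) ∣ s.2 * c.1 ^ 2 - s.1 * c.2 ^ 2) := by
  set Y : ℝ := ((2 * Cb ^ 2 * RN + 1 : ℕ) : ℝ) ^ (1 / 4 : ℝ) with hY
  have hY0 : 0 ≤ Y := Real.rpow_nonneg (Nat.cast_nonneg _) _
  have hroot : ∀ c ∈ intBox Cb, (((aOf s c).natAbs : ℕ) : ℝ) ^ (1 / 4 : ℝ) ≤ Y := by
    intro c hc
    refine Real.rpow_le_rpow (Nat.cast_nonneg _) ?_ (by norm_num)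
    exact_mod_cast (natAbs_aOf_le hs1 hs2 hc).trans (Nat.le_succ _)
  set CC' := (intBox Cb).filter fun c => aOf s c ≠ 0 with hCC'
  -- Step 1: Landreau termwise
  have step1 : tauSum Cb s ≤ ∑ c ∈ CC',
      KL * ∑ d ∈ ((aOf s c).natAbs.divisors).filter (fun d : ℕ => (d : ℝ) ≤ Y),
        ((d.divisors.card : ℕ) : ℝ) ^ ML := by
    unfold tauSum
    rw [hCC', sum_filter]
    refine sum_le_sum fun c hc => ?_
    split_ifs with h0
    · rw [sum_filter]
      exact hL _ (Int.natAbs_ne_zero.mpr h0) Y (hroot c hc)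
    · exact le_rfl
  -- Step 2: exchange
  have step2 : ∑ c ∈ CC', ∑ d ∈ ((aOf s c).natAbs.divisors).filter (fun d : ℕ => (d : ℝ) ≤ Y),
      ((d.divisors.card : ℕ) : ℝ) ^ ML =
      ∑ d ∈ Icc 1 ⌊Y⌋₊, ∑ c ∈ CC'.filter (fun c => d ∣ (aOf s c).natAbs),
        ((d.divisors.card : ℕ) : ℝ) ^ ML := by
    refine sum_comm' ?_
    intro c d
    simp only [hCC', mem_filter, Nat.mem_divisors, mem_Icc]
    constructor
    · rintro ⟨⟨hc, h0⟩, ⟨hdvd, -⟩, hdY⟩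
      have hd1 : 1 ≤ d := Nat.pos_of_dvd_of_pos hdvd (Nat.pos_of_ne_zero (Int.natAbs_ne_zero.mpr h0))
      exact ⟨⟨⟨hc, h0⟩, hdvd⟩, hd1, Nat.le_floor hdY⟩
    · rintro ⟨⟨⟨hc, h0⟩, hdvd⟩, hd1, hdY⟩
      refine ⟨⟨hc, h0⟩, ⟨hdvd, Int.natAbs_ne_zero.mpr h0⟩, ?_⟩
      exact le_trans (by exact_mod_cast hdY) (Nat.floor_le hY0)
  -- Step 3: the inner sums are cardinalities
  calc tauSum Cb s ≤ ∑ c ∈ CC', KL * ∑ d ∈ ((aOf s c).natAbs.divisors).filter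
        (fun d : ℕ => (d : ℝ) ≤ Y), ((d.divisors.card : ℕ) : ℝ) ^ ML := step1
    _ = KL * ∑ d ∈ Icc 1 ⌊Y⌋₊, ∑ c ∈ CC'.filter (fun c => d ∣ (aOf s c).natAbs),
        ((d.divisors.card : ℕ) : ℝ) ^ ML := by rw [← mul_sum, step2]
    _ ≤ KL * ∑ d ∈ Icc 1 ⌊Y⌋₊, ((d.divisors.card : ℕ) : ℝ) ^ ML *
        #((intBox Cb).filter fun c : ℤ × ℤ => (d : ℤ) ∣ s.2 * c.1 ^ 2 - s.1 * c.2 ^ 2) := by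
        refine mul_le_mul_of_nonneg_left (sum_le_sum fun d _ => ?_) hKL.le
        rw [sum_const, nsmul_eq_mul, mul_comm]
        refine mul_le_mul_of_nonneg_left ?_ (by positivity)
        have hsub : CC'.filter (fun c => d ∣ (aOf s c).natAbs) ⊆
            (intBox Cb).filter fun c : ℤ × ℤ => (d : ℤ) ∣ s.2 * c.1 ^ 2 - s.1 * c.2 ^ 2 := by
          intro c hc
          rw [mem_filter, hCC', mem_filter] at hc
          rw [mem_filter]
          refine ⟨hc.1.1, ?_⟩
          have : (d : ℤ) ∣ aOf s c := Int.natCast_dvd.mpr hc.2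
          unfold aOf at this
          rwa [show c.1 ^ 2 * s.2 - c.2 ^ 2 * s.1 = s.2 * c.1 ^ 2 - s.1 * c.2 ^ 2 by ring] at this
        exact_mod_cast card_le_card hsub

/-- **The box counts turned into gcd sums**: for `s₁ s₂ ≠ 0` and `Y ≥ 1`,
`∑_{d ≤ Y} τ(d)^{M} #{c : d ∣ s₂ c₁² - s₁ c₂²} ≤ 2 ((2C)² + Y²) C_Φ τ(|s₁ s₂|)^{M+4} (1 + log Y)^κ`
(`card_cbox_dvd_le`, Lemma 9.1 `quadCongrCount_le`, and `Φ` of `…GcdSums`). [cite: FriedlanderIwaniecAnnals1998, proof of Lemma 5.1] -/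
theorem sum_nbox_le {CΦ : ℝ} {κΦ ML : ℕ}
    (hΦ : ∀ m : ℕ, m ≠ 0 → ∀ Y : ℕ, 1 ≤ Y →
      ∑ d ∈ Icc 1 Y, (σ 0 d : ℝ) ^ (ML + 3) * Nat.gcd m d / d ≤
        CΦ * (σ 0 m : ℝ) ^ (ML + 3 + 1) * (1 + Real.log Y) ^ κΦ)
    (Cb : ℕ) {Yn : ℕ} (hYn : 1 ≤ Yn) {s : ℤ × ℤ} (hs1 : s.1 ≠ 0) (hs2 : s.2 ≠ 0) :
    ∑ d ∈ Icc 1 Yn, ((d.divisors.card : ℕ) : ℝ) ^ ML *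
        #((intBox Cb).filter fun c : ℤ × ℤ => (d : ℤ) ∣ s.2 * c.1 ^ 2 - s.1 * c.2 ^ 2) ≤
      2 * ((2 * Cb : ℝ) ^ 2 + (Yn : ℝ) ^ 2) * CΦ *
        (σ 0 (s.2 * s.1).natAbs : ℝ) ^ (ML + 4) * (1 + Real.log Yn) ^ κΦ := by
  set m : ℕ := (s.2 * s.1).natAbs with hm
  have hm0 : m ≠ 0 := Int.natAbs_ne_zero.mpr (mul_ne_zero hs2 hs1)
  -- termwise bound
  have hterm : ∀ d ∈ Icc 1 Yn, ((d.divisors.card : ℕ) : ℝ) ^ ML *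
      #((intBox Cb).filter fun c : ℤ × ℤ => (d : ℤ) ∣ s.2 * c.1 ^ 2 - s.1 * c.2 ^ 2) ≤
      2 * ((2 * Cb : ℝ) ^ 2 + (Yn : ℝ) ^ 2) * ((σ 0 d : ℝ) ^ (ML + 3) * Nat.gcd m d / d) := by
    intro d hd
    rw [mem_Icc] at hd
    have hd0 : 0 < d := hd.1
    have hdR : (0 : ℝ) < d := by exact_mod_cast hd0
    have hdY : (d : ℝ) ≤ Yn := by exact_mod_cast hd.2
    have h1 := card_cbox_dvd_le hd0 Cb s.1 s.2
    have h2 := quadCongrCount_le hd0 s.2 s.1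
    have hN : (#((intBox Cb).filter fun c : ℤ × ℤ => (d : ℤ) ∣ s.2 * c.1 ^ 2 - s.1 * c.2 ^ 2) : ℝ) ≤
        ((2 * Cb / d + 1 : ℕ) : ℝ) ^ 2 * (((d.divisors.card : ℕ) : ℝ) ^ 3 * d * Nat.gcd m d) := by
      have := h1.trans (Nat.mul_le_mul_left _ h2)
      rw [hm]
      exact_mod_cast this
    have hq : ((2 * Cb / d + 1 : ℕ) : ℝ) ≤ (2 * Cb : ℝ) / d + 1 := by
      have := (Nat.cast_div_le : ((2 * Cb / d : ℕ) : ℝ) ≤ (2 * Cb : ℕ) / (d : ℕ))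
      push_cast at this ⊢; linarith
    have hq2 : ((2 * Cb / d + 1 : ℕ) : ℝ) ^ 2 ≤ 2 * ((2 * Cb : ℝ) ^ 2 / (d : ℝ) ^ 2 + 1) := by
      calc ((2 * Cb / d + 1 : ℕ) : ℝ) ^ 2 ≤ ((2 * Cb : ℝ) / d + 1) ^ 2 :=
            pow_le_pow_left₀ (by positivity) hq 2
        _ ≤ 2 * ((2 * Cb : ℝ) ^ 2 / (d : ℝ) ^ 2 + 1) := by
            have hx : ((2 * Cb : ℝ) / d) ^ 2 = (2 * Cb : ℝ) ^ 2 / (d : ℝ) ^ 2 := div_pow _ _ 2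
            nlinarith [sq_nonneg ((2 * Cb : ℝ) / d - 1)]
    have hτ : ((d.divisors.card : ℕ) : ℝ) = (σ 0 d : ℝ) := by
      rw [ArithmeticFunction.sigma_zero_apply]
    rw [hτ] at hN ⊢
    have hg0 : (0 : ℝ) ≤ Nat.gcd m d := Nat.cast_nonneg _
    have hσ0 : (0 : ℝ) ≤ (σ 0 d : ℝ) := Nat.cast_nonneg _
    have hB0 : 0 ≤ (σ 0 d : ℝ) ^ 3 * d * Nat.gcd m d := by positivity
    calc (σ 0 d : ℝ) ^ ML * #((intBox Cb).filter fun c : ℤ × ℤ => (d : ℤ) ∣ s.2 * c.1 ^ 2 - s.1 * c.2 ^ 2)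
        ≤ (σ 0 d : ℝ) ^ ML * (((2 * Cb / d + 1 : ℕ) : ℝ) ^ 2 * ((σ 0 d : ℝ) ^ 3 * d * Nat.gcd m d)) :=
          mul_le_mul_of_nonneg_left hN (by positivity)
      _ ≤ (σ 0 d : ℝ) ^ ML * (2 * ((2 * Cb : ℝ) ^ 2 / (d : ℝ) ^ 2 + 1) * ((σ 0 d : ℝ) ^ 3 * d * Nat.gcd m d)) :=
          mul_le_mul_of_nonneg_left (mul_le_mul_of_nonneg_right hq2 hB0) (by positivity)
      _ = 2 * ((2 * Cb : ℝ) ^ 2 + (d : ℝ) ^ 2) * ((σ 0 d : ℝ) ^ (ML + 3) * Nat.gcd m d / d) := by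
          field_simp
          ring
      _ ≤ 2 * ((2 * Cb : ℝ) ^ 2 + (Yn : ℝ) ^ 2) * ((σ 0 d : ℝ) ^ (ML + 3) * Nat.gcd m d / d) := by
          have : (d : ℝ) ^ 2 ≤ (Yn : ℝ) ^ 2 := pow_le_pow_left₀ hdR.le hdY 2
          have h0 : 0 ≤ (σ 0 d : ℝ) ^ (ML + 3) * Nat.gcd m d / d := by positivity
          nlinarith
  calc ∑ d ∈ Icc 1 Yn, ((d.divisors.card : ℕ) : ℝ) ^ ML *
        #((intBox Cb).filter fun c : ℤ × ℤ => (d : ℤ) ∣ s.2 * c.1 ^ 2 - s.1 * c.2 ^ 2)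
      ≤ ∑ d ∈ Icc 1 Yn, 2 * ((2 * Cb : ℝ) ^ 2 + (Yn : ℝ) ^ 2) *
          ((σ 0 d : ℝ) ^ (ML + 3) * Nat.gcd m d / d) := sum_le_sum hterm
    _ = 2 * ((2 * Cb : ℝ) ^ 2 + (Yn : ℝ) ^ 2) *
          ∑ d ∈ Icc 1 Yn, (σ 0 d : ℝ) ^ (ML + 3) * Nat.gcd m d / d := by rw [mul_sum]
    _ ≤ 2 * ((2 * Cb : ℝ) ^ 2 + (Yn : ℝ) ^ 2) *
          (CΦ * (σ 0 m : ℝ) ^ (ML + 3 + 1) * (1 + Real.log Yn) ^ κΦ) :=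
        mul_le_mul_of_nonneg_left (hΦ m hm0 Yn hYn) (by positivity)
    _ = 2 * ((2 * Cb : ℝ) ^ 2 + (Yn : ℝ) ^ 2) * CΦ *
          (σ 0 (s.2 * s.1).natAbs : ℝ) ^ (ML + 4) * (1 + Real.log Yn) ^ κΦ := by
        rw [hm]; ring

/-! ### Sign reduction and the two parts of the main sum -/

/-- The pairs `s = (s₁, s₂)` of the main sum: `|s_i| ≤ R`, `|s₂| ≤ |s₁|`. [folklore] -/
def sPairs (R : ℕ) : Finset (ℤ × ℤ) :=
  (Icc (-(R : ℤ)) R ×ˢ Icc (-(R : ℤ)) R).filter fun s => s.2.natAbs ≤ s.1.natAbs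

/-- **Sign reduction**: a nonnegative function of `(|s₁|, |s₂|)` summed over the pairs with
`s₂ ≠ 0` (hence `s₁ ≠ 0`) is at most `4` times its sum over `1 ≤ t₂ ≤ t₁ ≤ R`. [folklore] -/
theorem sum_sPairs_natAbs_le (R : ℕ) (F : ℕ → ℕ → ℝ) (hF : ∀ t₁ t₂, 0 ≤ F t₁ t₂) :
    ∑ s ∈ (sPairs R).filter (fun s => ¬ s.2 = 0), F s.1.natAbs s.2.natAbs ≤
      4 * ∑ t₁ ∈ Icc 1 R, ∑ t₂ ∈ Icc 1 t₁, F t₁ t₂ := by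
  set S := (sPairs R).filter (fun s => ¬ s.2 = 0) with hS
  set T := ((Icc 1 R) ×ˢ (Icc 1 R)).filter (fun t : ℕ × ℕ => t.2 ≤ t.1) with hT
  set ψ : ℤ × ℤ → ℕ × ℕ := fun s => (s.1.natAbs, s.2.natAbs) with hψ
  have hmemS : ∀ s ∈ S, (s.1.natAbs ≤ R ∧ s.2.natAbs ≤ R) ∧ s.2.natAbs ≤ s.1.natAbs ∧
      1 ≤ s.2.natAbs := by
    intro s hs
    rw [hS, mem_filter, sPairs, mem_filter, mem_product, mem_Icc, mem_Icc] at hs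
    obtain ⟨⟨⟨h1, h2⟩, hle⟩, h0⟩ := hs
    refine ⟨⟨?_, ?_⟩, hle, Nat.one_le_iff_ne_zero.mpr (Int.natAbs_ne_zero.mpr h0)⟩
    · have : (s.1.natAbs : ℤ) ≤ R := by rw [Int.natCast_natAbs]; exact abs_le.mpr h1
      exact_mod_cast this
    · have : (s.2.natAbs : ℤ) ≤ R := by rw [Int.natCast_natAbs]; exact abs_le.mpr h2
      exact_mod_cast this
  have hmaps : ∀ s ∈ S, ψ s ∈ T := by
    intro s hs
    obtain ⟨⟨h1, h2⟩, hle, h0⟩ := hmemS s hs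
    simp only [hT, hψ, mem_filter, mem_product, mem_Icc]
    exact ⟨⟨⟨by omega, h1⟩, ⟨h0, h2⟩⟩, hle⟩
  -- rewrite the sum through the fibres of ψ
  have hrepl : ∀ s ∈ S, F s.1.natAbs s.2.natAbs = ∑ t ∈ T, if ψ s = t then F t.1 t.2 else 0 := by
    intro s hs
    rw [Finset.sum_ite_eq_of_mem T (ψ s) (fun t => F t.1 t.2) (hmaps s hs)]
  rw [sum_congr rfl hrepl, sum_comm]
  have hfib : ∀ t ∈ T, #(S.filter fun s => ψ s = t) ≤ 4 := by
    intro t _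
    calc #(S.filter fun s => ψ s = t)
        ≤ #({((t.1 : ℤ), (t.2 : ℤ)), (-(t.1 : ℤ), (t.2 : ℤ)), ((t.1 : ℤ), -(t.2 : ℤ)),
            (-(t.1 : ℤ), -(t.2 : ℤ))} : Finset (ℤ × ℤ)) := by
          refine card_le_card fun s hs => ?_
          rw [mem_filter] at hs
          obtain ⟨-, hst⟩ := hs
          simp only [hψ, Prod.ext_iff] at hst
          obtain ⟨h1, h2⟩ := hst
          simp only [mem_insert, mem_singleton, Prod.ext_iff]
          rcases Int.natAbs_eq s.1 with e1 | e1 <;> rcases Int.natAbs_eq s.2 with e2 | e2 <;>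
            rw [h1] at e1 <;> rw [h2] at e2 <;> simp [e1, e2]
      _ ≤ 4 := by
          refine (card_insert_le _ _).trans (Nat.succ_le_succ ((card_insert_le _ _).trans
            (Nat.succ_le_succ ((card_insert_le _ _).trans (Nat.succ_le_succ ?_)))))
          rw [card_singleton]
  calc ∑ t ∈ T, ∑ s ∈ S, (if ψ s = t then F t.1 t.2 else 0)
      = ∑ t ∈ T, (#(S.filter fun s => ψ s = t) : ℝ) * F t.1 t.2 := by
        refine sum_congr rfl fun t _ => ?_
        rw [← sum_filter, sum_const, nsmul_eq_mul]
    _ ≤ ∑ t ∈ T, 4 * F t.1 t.2 := by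
        refine sum_le_sum fun t ht => ?_
        exact mul_le_mul_of_nonneg_right (by exact_mod_cast hfib t ht) (hF _ _)
    _ = 4 * ∑ t₁ ∈ Icc 1 R, ∑ t₂ ∈ Icc 1 t₁, F t₁ t₂ := by
        rw [← mul_sum, hT, sum_filter, sum_product]
        congr 1
        refine sum_congr rfl fun t₁ ht₁ => ?_
        rw [mem_Icc] at ht₁
        rw [← sum_filter]
        congr 1
        ext t₂
        simp only [mem_filter, mem_Icc]
        omega

/-- **The part `s₂ = 0` of the main sum**:
`∑_{s₁} w(s₁, 0) Στ(s₁, 0) ≤ (2R + 2)(2C + 1) (∑_{|c| ≤ C} τ(|c|)²) (∑_{|s₁| ≤ R} τ(|s₁|))`.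
[cite: FriedlanderIwaniecAnnals1998, proof of Lemma 5.1] -/
theorem sum_sPairs_zero_le (Cb R : ℕ) :
    ∑ s ∈ (sPairs R).filter (fun s => s.2 = 0), wWeight R s * tauSum Cb s ≤
      (2 * R + 2) * (2 * Cb + 1) * (∑ c₂ ∈ Icc (-(Cb : ℤ)) Cb, ((σ 0 c₂.natAbs : ℕ) : ℝ) ^ 2) *
        ∑ s₁ ∈ Icc (-(R : ℤ)) R, ((σ 0 s₁.natAbs : ℕ) : ℝ) := by
  set T₂ := ∑ c₂ ∈ Icc (-(Cb : ℤ)) Cb, ((σ 0 c₂.natAbs : ℕ) : ℝ) ^ 2 with hT₂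
  have hT₂0 : 0 ≤ T₂ := sum_nonneg fun _ _ => by positivity
  have hset : (sPairs R).filter (fun s => s.2 = 0) = Icc (-(R : ℤ)) R ×ˢ ({0} : Finset ℤ) := by
    ext s
    simp only [sPairs, mem_filter, mem_product, mem_Icc, mem_singleton]
    constructor
    · rintro ⟨⟨⟨h1, -⟩, -⟩, h0⟩; exact ⟨h1, h0⟩
    · rintro ⟨h1, h0⟩
      refine ⟨⟨⟨h1, ?_⟩, ?_⟩, h0⟩
      · rw [h0]; constructor <;> linarith
      · rw [h0]; simp
  rw [hset, sum_product]
  simp only [sum_singleton]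
  rw [mul_sum]
  refine sum_le_sum fun s₁ _ => ?_
  rcases eq_or_ne s₁ 0 with h0 | h0
  · -- s₁ = 0: Στ(0, 0) = 0
    have : tauSum Cb (s₁, 0) = 0 := by
      unfold tauSum aOf
      refine sum_eq_zero fun c _ => ?_
      rw [h0]; simp
    rw [this, mul_zero]
    positivity
  · have hw : wWeight R (s₁, 0) = 2 * R + 2 := by
      unfold wWeight
      simp only [Int.gcd_zero_right]
      have hs : ((|s₁| : ℤ) : ℝ) = (s₁.natAbs : ℝ) := (Nat.cast_natAbs s₁).symm
      rw [hs, mul_div_assoc, div_self (by exact_mod_cast Int.natAbs_ne_zero.mpr h0)]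
      ring
    rw [hw]
    have h := tauSum_snd_zero_le Cb s₁
    calc (2 * R + 2 : ℝ) * tauSum Cb (s₁, 0)
        ≤ (2 * R + 2) * ((2 * Cb + 1) * ((σ 0 s₁.natAbs : ℕ) : ℝ) * T₂) :=
          mul_le_mul_of_nonneg_left h (by positivity)
      _ = (2 * R + 2) * (2 * Cb + 1) * T₂ * ((σ 0 s₁.natAbs : ℕ) : ℝ) := by ring

/-- **The part `s₂ ≠ 0` of the main sum**: with Landreau's constants `K_L, M_L`, `Φ`'s `C_Φ, κ_Φ`
and the weighted pair sum's `C_W, κ_W`,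
`∑_{s₂ ≠ 0} w(s) Στ(s) ≤ 2 K_L ((2C)² + Y²) C_Φ (1 + log Y)^{κ_Φ} · 4 C_W R² (1 + log R)^{κ_W}`,
`Y = ⌊(2C²R + 1)^{1/4}⌋`. [cite: FriedlanderIwaniecAnnals1998, proof of Lemma 5.1] -/
theorem sum_sPairs_nonzero_le {KL CΦ CW : ℝ} {ML κΦ κW : ℕ} (hKL : 0 < KL) (hCΦ : 0 < CΦ)
    (hL : ∀ n : ℕ, n ≠ 0 → ∀ y : ℝ, (n : ℝ) ^ (1 / 4 : ℝ) ≤ y →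
      (n.divisors.card : ℝ) ≤
        KL * ∑ d ∈ n.divisors, if (d : ℝ) ≤ y then ((d.divisors.card : ℕ) : ℝ) ^ ML else 0)
    (hΦ : ∀ m : ℕ, m ≠ 0 → ∀ Y : ℕ, 1 ≤ Y →
      ∑ d ∈ Icc 1 Y, (σ 0 d : ℝ) ^ (ML + 3) * Nat.gcd m d / d ≤
        CΦ * (σ 0 m : ℝ) ^ (ML + 3 + 1) * (1 + Real.log Y) ^ κΦ)
    (hW : ∀ R : ℕ, 1 ≤ R → ∑ t₁ ∈ Icc 1 R, ∑ t₂ ∈ Icc 1 t₁,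
      ((2 * R + 1) * (Nat.gcd t₁ t₂ : ℝ) / t₁ + 1) * (σ 0 t₁ : ℝ) ^ (ML + 4) * (σ 0 t₂ : ℝ) ^ (ML + 4)
        ≤ CW * (R : ℝ) ^ 2 * (1 + Real.log R) ^ κW)
    (Cb : ℕ) {R : ℕ} (hR : 1 ≤ R) :
    ∑ s ∈ (sPairs R).filter (fun s => ¬ s.2 = 0), wWeight R s * tauSum Cb s ≤
      (2 * KL * ((2 * Cb : ℝ) ^ 2 + (⌊((2 * Cb ^ 2 * R + 1 : ℕ) : ℝ) ^ (1 / 4 : ℝ)⌋₊ : ℝ) ^ 2) * CΦ *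
        (1 + Real.log (⌊((2 * Cb ^ 2 * R + 1 : ℕ) : ℝ) ^ (1 / 4 : ℝ)⌋₊ : ℕ)) ^ κΦ) *
      (4 * (CW * (R : ℝ) ^ 2 * (1 + Real.log R) ^ κW)) := by
  set Yn : ℕ := ⌊((2 * Cb ^ 2 * R + 1 : ℕ) : ℝ) ^ (1 / 4 : ℝ)⌋₊ with hYn
  have hYn1 : 1 ≤ Yn := by
    rw [hYn]
    refine Nat.le_floor ?_
    rw [Nat.cast_one]
    exact Real.one_le_rpow (by exact_mod_cast Nat.le_add_left 1 _) (by norm_num)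
  set E : ℝ := 2 * KL * ((2 * Cb : ℝ) ^ 2 + (Yn : ℝ) ^ 2) * CΦ * (1 + Real.log Yn) ^ κΦ with hE
  have hlogYn : 0 ≤ Real.log Yn := Real.log_nonneg (by exact_mod_cast hYn1)
  have hE0 : 0 ≤ E := by rw [hE]; positivity
  set ρ := ML + 4 with hρ
  set F : ℕ → ℕ → ℝ := fun t₁ t₂ =>
    ((2 * R + 1) * (Nat.gcd t₁ t₂ : ℝ) / t₁ + 1) * (σ 0 t₁ : ℝ) ^ ρ * (σ 0 t₂ : ℝ) ^ ρ with hF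
  have hF0 : ∀ t₁ t₂, 0 ≤ F t₁ t₂ := fun _ _ => by positivity
  -- termwise: w(s) Στ(s) ≤ E · F(|s₁|, |s₂|)
  have hterm : ∀ s ∈ (sPairs R).filter (fun s => ¬ s.2 = 0),
      wWeight R s * tauSum Cb s ≤ E * F s.1.natAbs s.2.natAbs := by
    intro s hs
    rw [mem_filter, sPairs, mem_filter, mem_product, mem_Icc, mem_Icc] at hs
    obtain ⟨⟨⟨h1, h2⟩, hle⟩, hs2⟩ := hs
    have hs2' : s.2 ≠ 0 := hs2
    have hs1' : s.1 ≠ 0 := by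
      intro h0
      have : s.2.natAbs = 0 := by rw [h0] at hle; simpa using hle
      exact hs2' (Int.natAbs_eq_zero.mp this)
    have hb1 : s.1.natAbs ≤ R := by
      have : (s.1.natAbs : ℤ) ≤ R := by rw [Int.natCast_natAbs]; exact abs_le.mpr h1
      exact_mod_cast this
    have hb2 : s.2.natAbs ≤ R := by
      have : (s.2.natAbs : ℤ) ≤ R := by rw [Int.natCast_natAbs]; exact abs_le.mpr h2
      exact_mod_cast this
    have hτ := tauSum_le_landreau hKL hL Cb R hb1 hb2
    have hN := sum_nbox_le (ML := ML) hΦ Cb hYn1 hs1' hs2'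
    have hmul : (σ 0 (s.2 * s.1).natAbs : ℝ) ^ ρ ≤ (σ 0 s.1.natAbs : ℝ) ^ ρ * (σ 0 s.2.natAbs : ℝ) ^ ρ := by
      rw [← mul_pow]
      refine pow_le_pow_left₀ (by positivity) ?_ ρ
      rw [Int.natAbs_mul, mul_comm]
      exact_mod_cast sigma_zero_mul_le s.1.natAbs s.2.natAbs
    have hw : wWeight R s = (2 * R + 1) * (Nat.gcd s.1.natAbs s.2.natAbs : ℝ) / s.1.natAbs + 1 := by
      unfold wWeight
      have hs : ((|s.1| : ℤ) : ℝ) = (s.1.natAbs : ℝ) := (Nat.cast_natAbs s.1).symm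
      rw [hs]
      rfl
    have hw0 : 0 ≤ wWeight R s := wWeight_nonneg R s
    calc wWeight R s * tauSum Cb s
        ≤ wWeight R s * (KL * ∑ d ∈ Icc 1 Yn, ((d.divisors.card : ℕ) : ℝ) ^ ML *
            #((intBox Cb).filter fun c : ℤ × ℤ => (d : ℤ) ∣ s.2 * c.1 ^ 2 - s.1 * c.2 ^ 2)) :=
          mul_le_mul_of_nonneg_left hτ hw0
      _ ≤ wWeight R s * (KL * (2 * ((2 * Cb : ℝ) ^ 2 + (Yn : ℝ) ^ 2) * CΦ *
            (σ 0 (s.2 * s.1).natAbs : ℝ) ^ (ML + 4) * (1 + Real.log Yn) ^ κΦ)) :=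
          mul_le_mul_of_nonneg_left (mul_le_mul_of_nonneg_left hN hKL.le) hw0
      _ ≤ wWeight R s * (KL * (2 * ((2 * Cb : ℝ) ^ 2 + (Yn : ℝ) ^ 2) * CΦ *
            ((σ 0 s.1.natAbs : ℝ) ^ ρ * (σ 0 s.2.natAbs : ℝ) ^ ρ) * (1 + Real.log Yn) ^ κΦ)) := by
          apply mul_le_mul_of_nonneg_left _ hw0
          apply mul_le_mul_of_nonneg_left _ hKL.le
          apply mul_le_mul_of_nonneg_right _ (by positivity)
          exact mul_le_mul_of_nonneg_left hmul (by positivity)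
      _ = E * F s.1.natAbs s.2.natAbs := by rw [hE, hF, hw]; ring
  calc ∑ s ∈ (sPairs R).filter (fun s => ¬ s.2 = 0), wWeight R s * tauSum Cb s
      ≤ ∑ s ∈ (sPairs R).filter (fun s => ¬ s.2 = 0), E * F s.1.natAbs s.2.natAbs := sum_le_sum hterm
    _ = E * ∑ s ∈ (sPairs R).filter (fun s => ¬ s.2 = 0), F s.1.natAbs s.2.natAbs := by rw [mul_sum]
    _ ≤ E * (4 * ∑ t₁ ∈ Icc 1 R, ∑ t₂ ∈ Icc 1 t₁, F t₁ t₂) :=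
        mul_le_mul_of_nonneg_left (sum_sPairs_natAbs_le R F hF0) hE0
    _ ≤ E * (4 * (CW * (R : ℝ) ^ 2 * (1 + Real.log R) ^ κW)) := by
        apply mul_le_mul_of_nonneg_left _ hE0
        exact mul_le_mul_of_nonneg_left (hW R hR) (by norm_num)

/-! ### Assembly -/

/-- Size facts for `C₀ = cRange R_M R_N`: `1 ≤ C₀ ≤ 3√(R_M R_N)`, `C₀² ≤ 9 R_M R_N`, `R_N ≤ C₀²`. [folklore] -/
theorem cRange_bounds {RM RN : ℕ} (hRN : 1 ≤ RN) (hRM : RN ≤ RM) :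
    1 ≤ cRange RM RN ∧ (cRange RM RN : ℝ) ≤ 3 * Real.sqrt ((RM : ℝ) * RN) ∧
    (cRange RM RN : ℝ) ^ 2 ≤ 9 * ((RM : ℝ) * RN) ∧ RN ≤ cRange RM RN ^ 2 := by
  have hRM1 : 1 ≤ RM := hRN.trans hRM
  have hP1 : (1 : ℝ) ≤ (RM : ℝ) * RN := by
    have : (1 : ℝ) ≤ RM := by exact_mod_cast hRM1
    have : (1 : ℝ) ≤ RN := by exact_mod_cast hRN
    nlinarith
  have hsq1 : 1 ≤ Real.sqrt ((RM : ℝ) * RN) := by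
    rw [show (1 : ℝ) = Real.sqrt 1 from Real.sqrt_one.symm]; exact Real.sqrt_le_sqrt hP1
  have hC1 : 1 ≤ cRange RM RN := Nat.le_add_left 1 _
  have hCle : (cRange RM RN : ℝ) ≤ 3 * Real.sqrt ((RM : ℝ) * RN) := by
    unfold cRange
    have hs : ((Nat.sqrt (2 * RM * RN) : ℕ) : ℝ) ≤ Real.sqrt (2 * ((RM : ℝ) * RN)) := by
      refine Real.le_sqrt_of_sq_le ?_
      have := Nat.sqrt_le' (2 * RM * RN)
      have : (((Nat.sqrt (2 * RM * RN)) ^ 2 : ℕ) : ℝ) ≤ ((2 * RM * RN : ℕ) : ℝ) := by exact_mod_cast this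
      push_cast at this; linarith
    have hsqrt2 : Real.sqrt 2 ≤ 3 / 2 := by
      rw [Real.sqrt_le_left (by norm_num)]; norm_num
    rw [Real.sqrt_mul (by norm_num)] at hs
    push_cast
    nlinarith [Real.sqrt_nonneg 2, Real.sqrt_nonneg ((RM : ℝ) * RN)]
  refine ⟨hC1, hCle, ?_, ?_⟩
  · calc (cRange RM RN : ℝ) ^ 2 ≤ (3 * Real.sqrt ((RM : ℝ) * RN)) ^ 2 :=
          pow_le_pow_left₀ (Nat.cast_nonneg _) hCle 2
      _ = 9 * ((RM : ℝ) * RN) := by rw [mul_pow, Real.sq_sqrt (by positivity)]; norm_num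
  · have := two_mul_lt_cRange_sq RM RN
    nlinarith

set_option maxHeartbeats 1600000 in
/-- **FI Lemma 5.1 (crude form).** There are `K, κ` such that for all `R_M ≥ R_N ≥ 1`,
`D ≤ K ((R_M R_N)^{3/2} + R_M R_N³) (1 + log(R_M R_N))^κ`, where
`D = Σ_{w ∈ [-R_M, R_M]² ∖ 0} Σ_{z₁, z₂ ∈ [-R_N, R_N]² primitive} 𝔷(Re w̄ z₁) 𝔷(Re w̄ z₂)` (`lemma51Count`).
With `R_M = ⌊2√M⌋`, `R_N = ⌊2√N⌋` this is the source's
`D(M, N) ≪ (M^{3/4} N^{3/4} + M^{1/2} N^{3/2}) (log MN)^{O(1)}` over the full discs.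
[cite: FriedlanderIwaniecAnnals1998, Lemma 5.1] -/
theorem lemma51Count_le : ∃ K : ℝ, 0 < K ∧ ∃ κ : ℕ, ∀ RM RN : ℕ, 1 ≤ RN → RN ≤ RM →
    (lemma51Count RM RN : ℝ) ≤
      K * (((RM : ℝ) * RN) ^ (3 / 2 : ℝ) + RM * (RN : ℝ) ^ 3) * (1 + Real.log ((RM : ℝ) * RN)) ^ κ := by
  obtain ⟨KL, hKL, ML, hL⟩ := Landreau.card_divisors_le_sum (ε := (1 / 4 : ℝ)) (by norm_num)
  obtain ⟨CΦ, hCΦ, κΦ, hΦ⟩ := exists_sum_tau_pow_gcd_div_le (ML + 3)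
  obtain ⟨CW, hCW, κW, hW⟩ := exists_weighted_pair_sum_le (ML + 4)
  obtain ⟨C1, hC1, κ1, h1⟩ := exists_sum_tau_pow_le_nat 1
  obtain ⟨C2, hC2, κ2, h2⟩ := exists_sum_tau_pow_le_nat 2
  set κ : ℕ := κ1 + κ2 + κΦ + κW + 1 with hκ
  refine ⟨1620 + 8 * (48 * 9 * 3 ^ κ2 * C1 * C2) + 8 * (64 * 9 * 4 ^ κΦ * KL * CΦ * CW),
    by positivity, κ, ?_⟩
  intro RM RN hRN hRM
  obtain ⟨hC1', hCle, hCsq, hRNC⟩ := cRange_bounds hRN hRM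
  set C := cRange RM RN with hCdef
  have hRM1 : 1 ≤ RM := hRN.trans hRM
  have hRMr : (1 : ℝ) ≤ RM := by exact_mod_cast hRM1
  have hRNr : (1 : ℝ) ≤ RN := by exact_mod_cast hRN
  have hRMN : (RN : ℝ) ≤ RM := by exact_mod_cast hRM
  have hCr : (1 : ℝ) ≤ C := by exact_mod_cast hC1'
  set P : ℝ := (RM : ℝ) * RN with hP
  have hP1 : 1 ≤ P := by rw [hP]; nlinarith
  set L : ℝ := 1 + Real.log P with hLdef
  have hlogP : 0 ≤ Real.log P := Real.log_nonneg hP1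
  have hL1 : 1 ≤ L := by rw [hLdef]; linarith
  -- logarithms
  have hlogRN : 1 + Real.log RN ≤ L := by
    rw [hLdef]
    have : Real.log RN ≤ Real.log P := Real.log_le_log (by linarith) (by rw [hP]; nlinarith)
    linarith
  have hlog3 : Real.log 3 ≤ 2 := by
    have := Real.log_le_sub_one_of_pos (show (0 : ℝ) < 3 by norm_num); linarith
  have hlog2 : Real.log 2 ≤ 1 := by
    have := Real.log_le_sub_one_of_pos (show (0 : ℝ) < 2 by norm_num); linarith
  have hlogC : Real.log C ≤ 2 + Real.log P := by
    have hsq : Real.sqrt P ≤ P := by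
      rw [Real.sqrt_le_left (by linarith)]; nlinarith
    calc Real.log C ≤ Real.log (3 * Real.sqrt P) := Real.log_le_log (by linarith) hCle
      _ = Real.log 3 + Real.log (Real.sqrt P) := Real.log_mul (by norm_num) (by
          have := Real.sqrt_pos.mpr (by linarith : (0 : ℝ) < P); linarith)
      _ ≤ 2 + Real.log P := by
          have : Real.log (Real.sqrt P) ≤ Real.log P :=
            Real.log_le_log (Real.sqrt_pos.mpr (by linarith)) hsq
          linarith
  have hlogC' : 1 + Real.log C ≤ 3 * L := by rw [hLdef]; linarith
  -- the parameter Yn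
  set Yn : ℕ := ⌊((2 * C ^ 2 * RN + 1 : ℕ) : ℝ) ^ (1 / 4 : ℝ)⌋₊ with hYn
  have hYn1 : 1 ≤ Yn := by
    rw [hYn]
    refine Nat.le_floor ?_
    rw [Nat.cast_one]
    exact Real.one_le_rpow (by exact_mod_cast Nat.le_add_left 1 _) (by norm_num)
  have hYnle : (Yn : ℝ) ≤ 2 * C := by
    have hbaseN : 2 * C ^ 2 * RN + 1 ≤ (2 * C) ^ 4 := by
      have hC4 : 1 ≤ C ^ 4 := Nat.one_le_pow _ _ hC1'
      calc 2 * C ^ 2 * RN + 1 ≤ 2 * C ^ 2 * C ^ 2 + C ^ 4 :=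
            Nat.add_le_add (Nat.mul_le_mul_left _ hRNC) hC4
        _ = 3 * C ^ 4 := by ring
        _ ≤ 16 * C ^ 4 := Nat.mul_le_mul_right _ (by norm_num)
        _ = (2 * C) ^ 4 := by ring
    have hbase : ((2 * C ^ 2 * RN + 1 : ℕ) : ℝ) ≤ ((2 * C : ℝ)) ^ (4 : ℕ) := by
      exact_mod_cast hbaseN
    calc (Yn : ℝ) ≤ ((2 * C ^ 2 * RN + 1 : ℕ) : ℝ) ^ (1 / 4 : ℝ) := Nat.floor_le (by positivity)
      _ ≤ (((2 * C : ℝ)) ^ (4 : ℕ)) ^ (1 / 4 : ℝ) :=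
          Real.rpow_le_rpow (by positivity) hbase (by norm_num)
      _ = 2 * C := by
          rw [show (1 / 4 : ℝ) = ((4 : ℕ) : ℝ)⁻¹ by norm_num,
            Real.pow_rpow_inv_natCast (by positivity) (by norm_num)]
  have hYn0 : (1 : ℝ) ≤ Yn := by exact_mod_cast hYn1
  have hlogYn : 1 + Real.log Yn ≤ 4 * L := by
    have : Real.log Yn ≤ Real.log 2 + Real.log C := by
      rw [← Real.log_mul (by norm_num) (by linarith)]
      exact Real.log_le_log (by linarith) hYnle
    rw [hLdef]; linarith
  -- Step 1: split the quintuples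
  have hsplit : (lemma51Count RM RN : ℝ) =
      (#((quintuples RM RN).filter fun x => det2 x.1.2.1 x.1.2.2 = 0) : ℝ) +
        #((quintuples RM RN).filter fun x => ¬ det2 x.1.2.1 x.1.2.2 = 0) := by
    rw [lemma51Count_eq_card]
    exact_mod_cast (Finset.card_filter_add_card_filter_not
      (s := quintuples RM RN) (fun x => det2 x.1.2.1 x.1.2.2 = 0)).symm
  -- Step 2: the diagonal
  have hdiag : (#((quintuples RM RN).filter fun x => det2 x.1.2.1 x.1.2.2 = 0) : ℝ) ≤
      1620 * P ^ (3 / 2 : ℝ) * L := by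
    have h := card_diag_le RM RN
    rw [← hCdef] at h
    have hsqrtP : Real.sqrt P * P = P ^ (3 / 2 : ℝ) := by
      rw [Real.sqrt_eq_rpow, ← Real.rpow_add_one (by linarith)]; norm_num
    have hRN2 : (RN : ℝ) ^ 2 ≤ P := by rw [hP]; nlinarith
    calc (#((quintuples RM RN).filter fun x => det2 x.1.2.1 x.1.2.2 = 0) : ℝ)
        ≤ 4 * (2 * C + 1) * ((2 * RM + 1) * (4 * (2 * RN + 1) * (1 + Real.log RN)) + (2 * RN + 1) ^ 2) := h
      _ ≤ 4 * (3 * C) * ((3 * RM) * (4 * (3 * RN) * L) + 9 * P * L) := by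
          have e1 : (2 * (C : ℝ) + 1) ≤ 3 * C := by linarith
          have e2 : (2 * (RM : ℝ) + 1) ≤ 3 * RM := by linarith
          have e3 : (2 * (RN : ℝ) + 1) ≤ 3 * RN := by linarith
          have e4 : (2 * (RN : ℝ) + 1) ^ 2 ≤ 9 * P * L := by
            calc (2 * (RN : ℝ) + 1) ^ 2 ≤ (3 * RN) ^ 2 := pow_le_pow_left₀ (by positivity) e3 2
              _ = 9 * (RN : ℝ) ^ 2 * 1 := by ring
              _ ≤ 9 * P * L := by gcongr
          have e5 : (1 + Real.log RN) ≤ L := hlogRN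
          have e6 : 0 ≤ 1 + Real.log RN := by linarith [Real.log_nonneg hRNr]
          gcongr
      _ = 540 * C * P * L := by rw [hP]; ring
      _ ≤ 540 * (3 * Real.sqrt P) * P * L := by gcongr
      _ = 1620 * P ^ (3 / 2 : ℝ) * L := by rw [← hsqrtP]; ring
  -- Step 3: off the diagonal, down to the main sum
  set Smain := ∑ s ∈ sPairs RN, wWeight RN s * tauSum C s with hSmain
  have hoff : (#((quintuples RM RN).filter fun x => ¬ det2 x.1.2.1 x.1.2.2 = 0) : ℝ) ≤ 8 * Smain := by
    have hU := card_setU_le RM RN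
    rw [← hCdef] at hU
    have hnat : #((quintuples RM RN).filter fun x => ¬ det2 x.1.2.1 x.1.2.2 = 0) ≤ 4 * #(setU RM RN) :=
      calc #((quintuples RM RN).filter fun x => ¬ det2 x.1.2.1 x.1.2.2 = 0)
          ≤ #(setTa RM RN) + #(setTb RM RN) := card_offdiag_le RM RN
        _ ≤ 2 * #(setTa RM RN) := by have := card_setTb_le RM RN; omega
        _ ≤ 2 * (2 * #(setTa' RM RN)) := Nat.mul_le_mul_left 2 (card_setTa_le RM RN)
        _ ≤ 4 * #(setU RM RN) := by have := card_setTa'_le RM RN; omega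
    calc (#((quintuples RM RN).filter fun x => ¬ det2 x.1.2.1 x.1.2.2 = 0) : ℝ)
        ≤ 4 * #(setU RM RN) := by exact_mod_cast hnat
      _ ≤ 4 * (2 * Smain) := by
          refine mul_le_mul_of_nonneg_left ?_ (by norm_num)
          rw [hSmain]; exact hU
      _ = 8 * Smain := by ring
  -- Step 4: split the main sum
  have hmain_split : Smain = ∑ s ∈ (sPairs RN).filter (fun s => s.2 = 0), wWeight RN s * tauSum C s +
      ∑ s ∈ (sPairs RN).filter (fun s => ¬ s.2 = 0), wWeight RN s * tauSum C s := by
    rw [hSmain]; exact (sum_filter_add_sum_filter_not _ _ _).symm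
  -- Step 5: the part s₂ = 0
  have hT₁ : ∑ s₁ ∈ Icc (-(RN : ℤ)) RN, ((σ 0 s₁.natAbs : ℕ) : ℝ) ≤ 2 * C1 * RN * L ^ κ1 := by
    have h := sum_Icc_tau_natAbs_pow_le (r := 1) le_rfl RN
    simp only [pow_one] at h
    have h' := h1 RN hRN
    simp only [pow_one] at h'
    calc ∑ s₁ ∈ Icc (-(RN : ℤ)) RN, ((σ 0 s₁.natAbs : ℕ) : ℝ)
        ≤ 2 * ∑ k ∈ Icc 1 RN, ((σ 0 k : ℕ) : ℝ) := h
      _ ≤ 2 * (C1 * RN * (1 + Real.log RN) ^ κ1) := by linarith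
      _ ≤ 2 * (C1 * RN * L ^ κ1) := by
          have : (1 + Real.log RN) ^ κ1 ≤ L ^ κ1 :=
            pow_le_pow_left₀ (by linarith [Real.log_nonneg hRNr]) hlogRN κ1
          have h0 : 0 ≤ C1 * RN := by positivity
          nlinarith
      _ = 2 * C1 * RN * L ^ κ1 := by ring
  have hT₂ : ∑ c₂ ∈ Icc (-(C : ℤ)) C, ((σ 0 c₂.natAbs : ℕ) : ℝ) ^ 2 ≤ 2 * C2 * C * (3 * L) ^ κ2 := by
    have h := sum_Icc_tau_natAbs_pow_le (r := 2) (by norm_num) C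
    have h' := h2 C hC1'
    calc ∑ c₂ ∈ Icc (-(C : ℤ)) C, ((σ 0 c₂.natAbs : ℕ) : ℝ) ^ 2
        ≤ 2 * ∑ k ∈ Icc 1 C, ((σ 0 k : ℕ) : ℝ) ^ 2 := h
      _ ≤ 2 * (C2 * C * (1 + Real.log C) ^ κ2) := by linarith
      _ ≤ 2 * (C2 * C * (3 * L) ^ κ2) := by
          have : (1 + Real.log C) ^ κ2 ≤ (3 * L) ^ κ2 :=
            pow_le_pow_left₀ (by linarith [Real.log_nonneg hCr]) hlogC' κ2
          have h0 : 0 ≤ C2 * C := by positivity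
          nlinarith
      _ = 2 * C2 * C * (3 * L) ^ κ2 := by ring
  have hzero : ∑ s ∈ (sPairs RN).filter (fun s => s.2 = 0), wWeight RN s * tauSum C s ≤
      (48 * 9 * 3 ^ κ2 * C1 * C2) * (RM * (RN : ℝ) ^ 3) * L ^ κ := by
    have h := sum_sPairs_zero_le C RN
    have hT₂0 : 0 ≤ ∑ c₂ ∈ Icc (-(C : ℤ)) C, ((σ 0 c₂.natAbs : ℕ) : ℝ) ^ 2 :=
      sum_nonneg fun _ _ => by positivity
    have hT₁0 : 0 ≤ ∑ s₁ ∈ Icc (-(RN : ℤ)) RN, ((σ 0 s₁.natAbs : ℕ) : ℝ) :=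
      sum_nonneg fun _ _ => by positivity
    calc ∑ s ∈ (sPairs RN).filter (fun s => s.2 = 0), wWeight RN s * tauSum C s
        ≤ (2 * RN + 2) * (2 * C + 1) * (∑ c₂ ∈ Icc (-(C : ℤ)) C, ((σ 0 c₂.natAbs : ℕ) : ℝ) ^ 2) *
            ∑ s₁ ∈ Icc (-(RN : ℤ)) RN, ((σ 0 s₁.natAbs : ℕ) : ℝ) := h
      _ ≤ (4 * RN) * (3 * C) * (2 * C2 * C * (3 * L) ^ κ2) * (2 * C1 * RN * L ^ κ1) := by
          have e1 : (2 * (RN : ℝ) + 2) ≤ 4 * RN := by linarith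
          have e2 : (2 * (C : ℝ) + 1) ≤ 3 * C := by linarith
          gcongr
      _ = (48 * 3 ^ κ2 * C1 * C2) * ((C : ℝ) ^ 2 * (RN : ℝ) ^ 2) * (L ^ κ2 * L ^ κ1) := by
          rw [mul_pow]; ring
      _ ≤ (48 * 3 ^ κ2 * C1 * C2) * (9 * P * (RN : ℝ) ^ 2) * L ^ κ := by
          have e1 : (C : ℝ) ^ 2 * (RN : ℝ) ^ 2 ≤ 9 * P * (RN : ℝ) ^ 2 :=
            mul_le_mul_of_nonneg_right hCsq (by positivity)
          have e2 : L ^ κ2 * L ^ κ1 ≤ L ^ κ := by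
            rw [← pow_add]; exact pow_le_pow_right₀ hL1 (by omega)
          have h0 : 0 ≤ (48 * 3 ^ κ2 * C1 * C2 : ℝ) := by positivity
          have h3 : 0 ≤ L ^ κ2 * L ^ κ1 := by positivity
          calc (48 * 3 ^ κ2 * C1 * C2) * ((C : ℝ) ^ 2 * (RN : ℝ) ^ 2) * (L ^ κ2 * L ^ κ1)
              ≤ (48 * 3 ^ κ2 * C1 * C2) * (9 * P * (RN : ℝ) ^ 2) * (L ^ κ2 * L ^ κ1) := by gcongr
            _ ≤ (48 * 3 ^ κ2 * C1 * C2) * (9 * P * (RN : ℝ) ^ 2) * L ^ κ := by gcongr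
      _ = (48 * 9 * 3 ^ κ2 * C1 * C2) * (RM * (RN : ℝ) ^ 3) * L ^ κ := by rw [hP]; ring
  -- Step 6: the part s₂ ≠ 0
  have hnonzero : ∑ s ∈ (sPairs RN).filter (fun s => ¬ s.2 = 0), wWeight RN s * tauSum C s ≤
      (64 * 9 * 4 ^ κΦ * KL * CΦ * CW) * (RM * (RN : ℝ) ^ 3) * L ^ κ := by
    have h := sum_sPairs_nonzero_le hKL hCΦ hL hΦ hW C hRN
    rw [← hYn] at h
    calc ∑ s ∈ (sPairs RN).filter (fun s => ¬ s.2 = 0), wWeight RN s * tauSum C s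
        ≤ (2 * KL * ((2 * C : ℝ) ^ 2 + (Yn : ℝ) ^ 2) * CΦ * (1 + Real.log Yn) ^ κΦ) *
            (4 * (CW * (RN : ℝ) ^ 2 * (1 + Real.log RN) ^ κW)) := h
      _ ≤ (2 * KL * ((2 * C : ℝ) ^ 2 + (2 * C : ℝ) ^ 2) * CΦ * (4 * L) ^ κΦ) *
            (4 * (CW * (RN : ℝ) ^ 2 * L ^ κW)) := by
          have e1 : (Yn : ℝ) ^ 2 ≤ (2 * C : ℝ) ^ 2 := pow_le_pow_left₀ (by positivity) hYnle 2
          have e2 : (1 + Real.log Yn) ^ κΦ ≤ (4 * L) ^ κΦ :=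
            pow_le_pow_left₀ (by linarith [Real.log_nonneg hYn0]) hlogYn κΦ
          have e3 : (1 + Real.log RN) ^ κW ≤ L ^ κW :=
            pow_le_pow_left₀ (by linarith [Real.log_nonneg hRNr]) hlogRN κW
          have e4 : 0 ≤ 1 + Real.log Yn := by linarith [Real.log_nonneg hYn0]
          have e5 : 0 ≤ 1 + Real.log RN := by linarith [Real.log_nonneg hRNr]
          gcongr
      _ = (64 * 4 ^ κΦ * KL * CΦ * CW) * ((C : ℝ) ^ 2 * (RN : ℝ) ^ 2) * (L ^ κΦ * L ^ κW) := by
          rw [mul_pow, mul_pow]; ring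
      _ ≤ (64 * 4 ^ κΦ * KL * CΦ * CW) * (9 * P * (RN : ℝ) ^ 2) * L ^ κ := by
          have e1 : (C : ℝ) ^ 2 * (RN : ℝ) ^ 2 ≤ 9 * P * (RN : ℝ) ^ 2 :=
            mul_le_mul_of_nonneg_right hCsq (by positivity)
          have e2 : L ^ κΦ * L ^ κW ≤ L ^ κ := by
            rw [← pow_add]; exact pow_le_pow_right₀ hL1 (by omega)
          have h0 : 0 ≤ (64 * 4 ^ κΦ * KL * CΦ * CW : ℝ) := by positivity
          have h3 : 0 ≤ L ^ κΦ * L ^ κW := by positivity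
          calc (64 * 4 ^ κΦ * KL * CΦ * CW) * ((C : ℝ) ^ 2 * (RN : ℝ) ^ 2) * (L ^ κΦ * L ^ κW)
              ≤ (64 * 4 ^ κΦ * KL * CΦ * CW) * (9 * P * (RN : ℝ) ^ 2) * (L ^ κΦ * L ^ κW) := by gcongr
            _ ≤ (64 * 4 ^ κΦ * KL * CΦ * CW) * (9 * P * (RN : ℝ) ^ 2) * L ^ κ := by gcongr
      _ = (64 * 9 * 4 ^ κΦ * KL * CΦ * CW) * (RM * (RN : ℝ) ^ 3) * L ^ κ := by rw [hP]; ring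
  -- Step 7: combine
  have hLκ : L ≤ L ^ κ := by
    calc L = L ^ 1 := (pow_one L).symm
      _ ≤ L ^ κ := pow_le_pow_right₀ hL1 (by omega)
  have hA0 : 0 ≤ P ^ (3 / 2 : ℝ) := by positivity
  have hB0 : 0 ≤ (RM : ℝ) * (RN : ℝ) ^ 3 := by positivity
  have hSmain_le : Smain ≤ ((48 * 9 * 3 ^ κ2 * C1 * C2) + (64 * 9 * 4 ^ κΦ * KL * CΦ * CW)) *
      (RM * (RN : ℝ) ^ 3) * L ^ κ := by rw [hmain_split]; linarith
  calc (lemma51Count RM RN : ℝ)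
      = (#((quintuples RM RN).filter fun x => det2 x.1.2.1 x.1.2.2 = 0) : ℝ) +
          #((quintuples RM RN).filter fun x => ¬ det2 x.1.2.1 x.1.2.2 = 0) := hsplit
    _ ≤ 1620 * P ^ (3 / 2 : ℝ) * L + 8 * Smain := add_le_add hdiag hoff
    _ ≤ 1620 * P ^ (3 / 2 : ℝ) * L ^ κ +
          8 * (((48 * 9 * 3 ^ κ2 * C1 * C2) + (64 * 9 * 4 ^ κΦ * KL * CΦ * CW)) *
            (RM * (RN : ℝ) ^ 3) * L ^ κ) := by
        gcongr
    _ ≤ 1620 * P ^ (3 / 2 : ℝ) * L ^ κ +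
          8 * (((48 * 9 * 3 ^ κ2 * C1 * C2) + (64 * 9 * 4 ^ κΦ * KL * CΦ * CW)) *
            (RM * (RN : ℝ) ^ 3) * L ^ κ) +
          (1620 * (RM * (RN : ℝ) ^ 3) * L ^ κ +
            8 * (((48 * 9 * 3 ^ κ2 * C1 * C2) + (64 * 9 * 4 ^ κΦ * KL * CΦ * CW)) *
              P ^ (3 / 2 : ℝ) * L ^ κ)) :=
        le_add_of_nonneg_right (by positivity)
    _ = (1620 + 8 * (48 * 9 * 3 ^ κ2 * C1 * C2) + 8 * (64 * 9 * 4 ^ κΦ * KL * CΦ * CW)) *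
          (P ^ (3 / 2 : ℝ) + RM * (RN : ℝ) ^ 3) * L ^ κ := by ring

end Literature.NumberTheory.Sieve.FriedlanderIwaniecPrimes

end
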